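import Literature.MathematicalPhysics.QuantumFieldTheory.Balaban1983to89.B5Hk160Torus

/-!
# Bałaban 1984 (Propagators I), Sect. D pp.26–28: the Lagrange function (1.48), the Lagrange system
(1.49), and the derivation (1.50)–(1.57) of the minimal configuration (1.59) — on the double torus

T. Bałaban, *Propagators and renormalization transformations for lattice gauge theories. I*,
Commun. Math. Phys. **95** (1984) 17–40, Sect. D «The propagators for the renormalization
transformations with linear averaging operations», pp.26–28. [cite: Balaban1984PropagatorsI]

THE SOURCE, verbatim (formulas read from the page images). p.26: «… minimizing the form ½⟨∂A, ∂A⟩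
under the conditions Q_kA = B, R∂*A = 0. Let us calculate this minimum. We introduce the function
  h(A, ω, λ) = ½⟨∂A, ∂A⟩ + ⟨ω, Q_kA − B⟩ + ⟨λ, R∂*A⟩
            = ½⟨A, ΔA⟩ − ½⟨∂*A, ∂*A⟩ + ⟨ω, Q_kA − B⟩ + ⟨λ, R∂*A⟩,  Rλ = λ,                    (1.48)
and we consider the equations
  δh/δA = ΔA − ∂∂*A + Q_k*ω + ∂λ = 0,  δh/δω = Q_kA − B = 0,  δh/δλ = R∂*A = 0.              (1.49)
We have R∂*A = ∂*A − Δ⁻¹Q′_k*(Q′_kΔ⁻²Q′_k*)⁻¹Q′_kΔ⁻¹∂*A = 0, so the first equation has the form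
  ΔA − ∂Δ⁻¹Q′_k*(Q′_kΔ⁻²Q′_k*)⁻¹Q′_kΔ⁻¹∂*A + Q_k*ω + ∂λ = 0.                                  (1.50)»
p.27: «It implies that ω is orthogonal to constant functions. Introducing the new variables
A′ = Δ^{1/2}A, and dividing by Δ^{1/2}, we have
  A′ − ∂Δ^{-3/2}Q′_k*(Q′_kΔ⁻²Q′_k*)⁻¹Q′_kΔ^{-3/2}∂*A′ + Δ^{-1/2}Q_k*ω + Δ^{-1/2}∂λ = 0.            (1.51)
Let us notice that A′ is orthogonal to constant functions also. This can be written as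
  (I − P)A′ + Δ^{-1/2}Q_k*ω + Δ^{-1/2}∂λ = 0.                                                  (1.52)
A solvability condition for this equation is
  PΔ^{-1/2}Q_k*ω + PΔ^{-1/2}∂λ = PΔ^{-1/2}Q_k*ω + ∂Δ^{-1/2}(I − R)λ = PΔ^{-1/2}Q_k*ω = 0.         (1.53)
We have the decomposition
  A′ = (I − P)A′ + PA′ = A′₁ + A′₂,  A′₁ = −Δ^{-1/2}Q_k*ω − Δ^{-1/2}∂λ,
  A′₂ = ∂Δ^{-3/2}Q′_k*(Q′_kΔ⁻²Q′_k*)⁻¹λ′,                                                     (1.54)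
where λ′ = Q′_kΔ^{-3/2}∂*A′. The configuration A can be expressed in terms of A′ as follows:
A = Δ^{-1/2}A′ + A₀, where A₀ is a constant configuration. Substituting it into the other two equations
in (1.49) and using the identity
  Q_k∂ = ∂₁Q′_k,                                                                              (1.55)
∂₁ is the unit lattice differentiation, we get
  Q_kΔ^{-1/2}A′₁ + ∂₁λ′ + Q_kA₀ = −Q_kΔ⁻¹Q_k*ω − Q_kΔ⁻¹∂λ + ∂₁λ′ + Q_kA₀ = B,
  −R∂*Δ⁻¹Q_k*ω − R∂*Δ⁻¹∂λ + RΔ⁻¹Q′_k*(Q′_kΔ⁻²Q′_k*)⁻¹λ′ = −RΔ⁻¹Q′_k*∂₁*ω − Rλ = −λ = 0,          (1.56)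
so for λ = 0 the third equation in (1.49) is satisfied automatically. The second equation gets the form
  −Q_kΔ⁻¹Q_k*ω + ∂₁λ′ + Q_kA₀ = B.                                                             (1.57)
It implies that B − Q_kA₀ is orthogonal to constant functions. Taking the decomposition B = B′ + B₀,
where B₀ is a constant configuration and B′ is in the orthogonal subspace, we can identify Q_kA₀ = B₀,
or A₀ = Q_k*B₀. Further we have the solvability condition (1.53)
PΔ^{-1/2}Q_k*ω = ∂Δ^{-3/2}Q′_k*(Q′_kΔ⁻²Q′_k*)⁻¹Q′_kΔ⁻²Q′_k*∂₁*ω = 0, which is equivalent to ∂₁*ω = 0.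
Let us introduce the operator φ = Q_kΔ⁻¹Q_k*. (1.58) Equation (1.57) can be solved with respect to ω
and we get ω = + φ⁻¹∂₁λ′ − φ⁻¹B′. The solvability condition gives the equation
∂₁*ω = ∂₁*φ⁻¹∂₁λ′ − ∂₁*φ⁻¹B′ = 0. This equation can be solved with respect to λ′, and we get
λ′ = (∂₁*φ⁻¹∂₁)⁻¹∂₁*φ⁻¹B′. These calculations lead to the following result for the minimal
configuration» p.28: «A, i.e. for the solution of Eq. (1.49):
  A = Δ⁻¹Q_k*(φ⁻¹B′ − φ⁻¹∂₁(∂₁*φ⁻¹∂₁)⁻¹∂₁*φ⁻¹B′) + ∂Δ⁻²Q′_k*(Q′_kΔ⁻²Q′_k*)⁻¹(∂₁*φ⁻¹∂₁)⁻¹∂₁*φ⁻¹B′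
      + Q_k*B₀.                                                                               (1.59)»

WHAT THIS LEAF CERTIFIES (kernel-checked, `sorry`-free, no hypotheses other than the printed ones).
The tree already has (1.59) = (1.60) = (1.63) and the constrained-minimum characterisation of `H_kB`
(`B5Hk160Torus`, `B5Hk163RDiv`, `B5Hk164Transl`), but the Lagrange-multiplier DERIVATION (1.48)–(1.57)
itself had no kernel coverage. Here, in the torus conventions of the Balaban1983to89 leaves
(`T_η = Tor (fine n M)`, spacing `η = n⁻¹ = L^{-k}`, `T₁^{(k)} = Tor M`, `Q_k = B5Block118.QvOp`,
`Q′_k = QsOp`, `Δ⁻¹ = B5LaplaceInverse.LapSinv` with value `0` on constants, `R = I − P = 1 − B5Value126.PcT`):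
* §1 the real powers `Δ^s` (`A′ = Δ^{1/2}A`, `Δ^{-1/2}`, `Δ^{-3/2}` of (1.51)–(1.54)) as Fourier
  multipliers `lpow/LapPowS/LapPowV` with the symbol calculus `Δ^sΔ^t = Δ^{s+t}`, `Δ^1 = Δ`,
  `Δ^{-1} = Δ⁻¹`, `Δ^{-2} = Δ⁻²`, `Δ^s∂ = ∂Δ^s`, `∂*Δ^s = Δ^s∂*`, and «A = Δ^{-1/2}A′ + A₀»
  (`LapPowV_negHalf_half`, `A_decomp`: `Δ^{-1/2}Δ^{1/2}A = A − A₀`, `A₀` the componentwise mean);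
* §2 the scalar products (1.21) (`ipF`, `ipS`, `ipC`; `Q_k* = B5DeltaA169.QvAdj` IS the adjoint,
  `ipC_QvOp`), the Lagrange function (1.48) `hLag` (both printed expressions: `e148a`, `e148b`), its
  exact first/second-order expansions in `A`, `ω`, `λ` (`hLag_add_A/omega/lam`) exhibiting the three
  displayed variations, the system (1.49) `EL149`, «(1.49) ⟺ h stationary» (`el149_iff_stationary`),
  and the Lagrange principle «(1.49) ⇒ A minimises ½⟨∂A, ∂A⟩ on {Q_kA = B, R∂*A = 0}»
  (`cEnergy_le_of_el149`);
* §3 (1.50) `e150`, «ω ⊥ constants» `orthConst_omega`, (1.51) `e151`, «A′ ⊥ constants» `orthConst_Ap`,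
  the projection `P = Pv` with `P² = P` (`Pv_mulVec_Pv`), (1.52) `e152`, (1.53) `e153a`,
  `Pv_negHalf_GradOp` («PΔ^{-1/2}∂λ = ∂Δ^{-1/2}(I − R)λ»), `e153`, (1.54) `e154` with `λ′ = lamp`;
* §4 (1.55) (= `B5Hk160Torus.QvOp_GradOp_mulVec`), (1.56) first line `e156a`, second line `e156b`,
  «λ» `lam_const`, (1.57) `e157`, «B − Q_kA₀ ⊥ constants» `orthConst_B_sub`, «Q_kA₀ = B₀» `QvOp_A0`,
  «A₀ = Q_k*B₀» `A0_eq`, the displayed solvability condition `e153_display` and «equivalent to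
  ∂₁*ω = 0» `e153_iff`, «ω = φ⁻¹∂₁λ′ − φ⁻¹B′» `omega_eq`, «∂₁*ω = ∂₁*φ⁻¹∂₁λ′ − ∂₁*φ⁻¹B′ = 0»
  `e153_solved`, «λ′ = (∂₁*φ⁻¹∂₁)⁻¹∂₁*φ⁻¹B′» `lamp_eq_Lam` (`= B5Hk160Torus.Lam`);
* §5 (1.59): EVERY solution `(A, ω, λ)`, `Rλ = λ`, of (1.49) has `A =` (1.59) `= B5Hk160Torus.H159 =
  H160 = H_kB` (`A_eq_H159`, `A_eq_H160`), `ω = B5Hk160Torus.omegaW`, `λ` constant (`multipliers_eq`);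
  CONVERSELY `(H_kB, omegaW B, const)` solves (1.49) (`el149_H160`); hence (1.49) is solvable at `A`
  iff `A = H_kB` iff `A` is the constrained minimiser (`exists_el149_iff`, `isConstrainedMin_iff`,
  `exists_el149_iff_isConstrainedMin`) — the paper's «the minimal configuration A, i.e. … the solution
  of Eq. (1.49)» in both directions.

HONEST SCOPE. (a) Setting: the double torus of the Balaban1983to89 leaves (finite periodic lattices,
`L_μ = M_μ` unit periods, `η = 1/n`), complex-valued configurations (the paper's are real; `h` is typed
through real parts, which changes nothing for real fields), `d` arbitrary. (b) `Δ^{±1/2}`, `Δ^{-3/2}`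
are the spectral real powers with value `0` on the zero mode — the convention the paper itself uses
for `Δ⁻¹` (Sect. C p.22) and the only one under which «dividing by Δ^{1/2}» and «A = Δ^{-1/2}A′ + A₀»
are both meaningful on a torus; every use is an identity certified here, none is assumed.
(c) `(Q′_kΔ⁻²Q′_k*)⁻¹`, `φ⁻¹`, `(∂₁*φ⁻¹∂₁)⁻¹` are the tree's inverses on the mean-free subspaces
(`B5Substitution125.Minv`/`B5Hk160Torus.Einv`, `B5Phi162Torus.PhiInv`, `B5Hk160Torus.GPhiInv`); each
is applied only to mean-free arguments, as certified at each step (`orthConst_omega`, `sum_lamp`, …).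
(d) Nothing on pp.26–28 between «Let us calculate this minimum» and (1.59) is left uncertified; the
value of the minimum and (1.60)–(1.64) are the business of `B5Hk160Torus`/`B5Hk164Transl`.

DIVERGENCE (typed statement vs source, word by word). (i) «−RΔ⁻¹Q′_k*∂₁*ω − Rλ = −λ = 0» / «for
λ = 0»: in print `R` is «the projection operator acting on ∂*A» (p.24 before (1.38)), i.e. it acts on
the space of divergences, which are orthogonal to constants («(∂*A)~(0) = 0», p.24); there `Rλ = λ`
forces `λ ⊥ 1`, `∂*Δ⁻¹∂λ = λ`, and the printed conclusion `λ = 0` is exact. The TYPED `R = 1 − PcT`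
acts on ALL scalar functions on `T_η` and fixes the constants (`R_const`), so the typed conclusion is
`λ = λ̄` (a constant, `λ̄` = the mean of `λ`) and `∂λ = 0` (`lam_const`) — the same statement modulo
the domain convention; the system (1.49) is blind to a constant in `λ` (`el149_H160 B a` for every
`a`), and (1.59) is unaffected. (ii) Adjoints: `Q_k* =
QvAdj = η^{-d}(Q_k)ᴴ`, `Q′_k* = QsAdj = η^{-d}(Q′_k)ᴴ` (adjoints for (1.21)), `(Q′_kΔ⁻²Q′_k*)⁻¹ = Einv =
η^{d}·Minv`; the printed products `Q′_k*(Q′_kΔ⁻²Q′_k*)⁻¹ = (Q′_k)ᴴMinv` are convention-free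
(`B5Hk160Torus.QsAdj_Einv`). (iii) (1.49)'s first equation is typed expanded, «ΔA − ∂∂*A + …»
(`= (Δ − ∂∂*)A`, `Lap_sub_GradDiv`, `B5Hk163RDiv.DstarD`). (iv) (1.53)'s middle expression is typed
with `(I − R) = 1 − (1 − PcT)`. (v) `⟨·,·⟩` carries the weight `η^d` on `T_η` and weight `1` on
`T₁^{(k)}` as in (1.21); `h` is real-valued (real parts).

ABSOLUTE-RULE census: imports `B5Hk160Torus` only (tree); no `axiom`, no `sorry`, no named-fact
hypothesis (`(h : SomeFact)`) anywhere — every `theorem` below is proved from the tree's definitions;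
`[cite: …]` tags are text locators, not appeals. Provenance: lineage b05 (Bałaban, Propagators I),
gen 13, node 2 (LAGRANGE-148-159).

v1.1 (DOCSTRING-ONLY over v1, p191053): DIVERGENCE (i) and the docstrings of `e156b`, `lam_const` now
record that the printed `R` is «the projection operator acting on ∂*A» (p.24, (1.38)) — on that space
(functions orthogonal to constants) `Rλ = λ` gives `λ ⊥ 1` and the printed «λ = 0» is exact, while the
typed `R = 1 − PcT` on all scalar functions gives «λ constant»; no declaration changed.
-/

open scoped BigOperators Matrix ComplexConjugate
open Finset Complex

namespace Literature.MathematicalPhysics.QuantumFieldTheory.Balaban1983to89.B5Lagrange149Torus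

open Literature.MathematicalPhysics.QuantumFieldTheory.Balaban1983to89
open Literature.MathematicalPhysics.QuantumFieldTheory.Balaban1983to89.B5Prop11Plancherel (Tor dft fine)
open Literature.MathematicalPhysics.QuantumFieldTheory.Balaban1983to89.B5Prop11Lower (Lap)
open Literature.MathematicalPhysics.QuantumFieldTheory.Balaban1983to89.B5Action121 (comp sdiff LapS
  GradOp divS Fs GradOp_mulVec GradOp_conjTranspose_mulVec_eq star_mulVec_dotProduct
  dotProduct_mulVec_eq_star_conjTranspose_mulVec)
open Literature.MathematicalPhysics.QuantumFieldTheory.Balaban1983to89.B5Block118 (QsOp QvOp cT)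
open Literature.MathematicalPhysics.QuantumFieldTheory.Balaban1983to89.B5LaplaceInverse (ssym lsym LapSinv
  LapSinv_const sum_LapSinv)
open Literature.MathematicalPhysics.QuantumFieldTheory.Balaban1983to89.B5LaplaceSpectral (sdiff_const
  const_of_sdiff_eq_zero)
open Literature.MathematicalPhysics.QuantumFieldTheory.Balaban1983to89.B5Momentum130 (dft_zero_apply
  lsym_zero lsym_eq_zero_iff dft_LapS_apply)
open Literature.MathematicalPhysics.QuantumFieldTheory.Balaban1983to89.B5Momentum133 (dft_LapSinv_apply
  lsym_eq_sum_norm_sq)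
open Literature.MathematicalPhysics.QuantumFieldTheory.Balaban1983to89.B5DeltaA169 (QvAdj QvAdj_adjoint
  dft_comp_GradOp dft_GradOp_adjoint)
open Literature.MathematicalPhysics.QuantumFieldTheory.Balaban1983to89.B5Substitution125 (Mop Minv
  Mop_mulVec Mop_Minv_of_orth Minv_Mop_of_orth sum_QsOp_adjoint QsOp_adjoint_injective QsOp_orth)
open Literature.MathematicalPhysics.QuantumFieldTheory.Balaban1983to89.B5Value126 (PcT PcT_mulVec
  PcT_conjTranspose sum_Minv_of_orth LapS_LapSinv_LapSinv)
open Literature.MathematicalPhysics.QuantumFieldTheory.Balaban1983to89.B5Blocks16 (sum_QsOp)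
open Literature.MathematicalPhysics.QuantumFieldTheory.Balaban1983to89.B5Constraint130 (sum_QvOp)
open Literature.MathematicalPhysics.QuantumFieldTheory.Balaban1983to89.B5DivOrth (sum_divS)
open Literature.MathematicalPhysics.QuantumFieldTheory.Balaban1983to89.B5Hk163Torus (dft_mulVec_injective)
open Literature.MathematicalPhysics.QuantumFieldTheory.Balaban1983to89.B5Hk163RDiv (DstarD
  DstarD_conjTranspose form_DstarD)
open Literature.MathematicalPhysics.QuantumFieldTheory.Balaban1983to89.B5Hk164Transl (cEnergy cEnergy_nonneg)
open Literature.MathematicalPhysics.QuantumFieldTheory.Balaban1983to89.B5Phi162Torus (liftV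
  comp_liftV_mulVec comp_smul eq_of_comp_eq OrthConst dft_comp_zero_of_orthConst
  orthConst_of_dft_comp_zero dft_const_of_ne LapVinv comp_LapVinv_mulVec PhiOp PhiOp_mulVec PhiInv
  PhiInv_PhiOp_of_orthConst)
open Literature.MathematicalPhysics.QuantumFieldTheory.Balaban1983to89.B5Hk160Torus (sum_eq_zero_iff_dft_zero
  sMul dft_sMul ssym_zero divS_GradOp_mulVec orthConst_GradOp constV divS_constV orthConst_sub
  dft_comp_Lap divS_LapVinv Lap_GradOp_mulVec QvAdj_constV QvOp_constV orthConst_QvAdj B0 Bp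
  orthConst_Bp Bp_add_B0 P0M P0M_mulVec QvOp_QvAdj_B0 QvOp_GradOp_mulVec QsAdj divS_QvAdj Einv
  QsAdj_Einv QsOp_LapSinv2_QsAdj_Einv GPhi gsym dft_GPhi gsym_zero gsym_ne_zero GPhiInv Lam sum_Lam
  Bpp omegaW omegaW_eq theta H159 H160 H159_eq_H160 QvOp_H160 R_divS_H160 DstarD_H160 H160_minimum
  H160_unique)

noncomputable section

variable {d : ℕ}

/-! ## §1 Real powers `Δ^s` of the Laplace operator as Fourier multipliers -/

section Scalar

variable (N : Fin d → ℕ) [hN : ∀ ν, NeZero (N ν)]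

/-- the symbol `Δ(p) = Σ_ν |∂_ν(p)|² ≥ 0` of `Δ = B5Action121.LapS` as a REAL number
(`B5Momentum133.lsym_eq_sum_norm_sq`). [cite: Balaban1984PropagatorsI, (1.31) p.23] -/
def lre (c : ℂ) (p : Tor N) : ℝ := ∑ ν, ‖ssym N c ν p‖ ^ 2

/-- `Δ(p) = ↑(lre p)`. [folklore] -/
theorem lsym_eq_lre (c : ℂ) (p : Tor N) : lsym N c p = ((lre N c p : ℝ) : ℂ) :=
  lsym_eq_sum_norm_sq N c p

/-- `Δ(p) ≥ 0`. [folklore] -/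
theorem lre_nonneg (c : ℂ) (p : Tor N) : 0 ≤ lre N c p :=
  Finset.sum_nonneg fun ν _ => by positivity

/-- `Δ(0) = 0`. [folklore] -/
theorem lre_zero (c : ℂ) : lre N c 0 = 0 := by
  simp [lre, ssym_zero]

/-- `Δ(p) = 0 ↔ p = 0` (`c ≠ 0`). [folklore] -/
theorem lre_eq_zero_iff {c : ℂ} (hc : c ≠ 0) (p : Tor N) : lre N c p = 0 ↔ p = 0 := by
  rw [← lsym_eq_zero_iff N hc p, lsym_eq_lre, Complex.ofReal_eq_zero]

/-- `Δ(p) > 0` off the zero mode. [folklore] -/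
theorem lre_pos {c : ℂ} (hc : c ≠ 0) {p : Tor N} (hp : p ≠ 0) : 0 < lre N c p :=
  lt_of_le_of_ne (lre_nonneg N c p) fun h => hp ((lre_eq_zero_iff N hc p).mp h.symm)

/-- the symbol `Δ(p)^s` of the REAL POWER `Δ^s`, `s ∈ ℝ` (`Real.rpow`; its value on the zero mode
is `0` for every `s ≠ 0` — for `s < 0` this is the convention of the tree's `Δ⁻¹ =
B5LaplaceInverse.LapSinv` «putting its value on constant functions equal to 0», Sect. C p.22).
[cite: Balaban1984PropagatorsI, p.27 «A′ = Δ^{1/2}A», (1.51) `Δ^{-3/2}`, `Δ^{-1/2}`] -/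
def lpow (c : ℂ) (s : ℝ) (p : Tor N) : ℂ := (((lre N c p) ^ s : ℝ) : ℂ)

/-- `Δ(0)^s = 0` for `s ≠ 0`. [folklore] -/
theorem lpow_zero_mode (c : ℂ) {s : ℝ} (hs : s ≠ 0) : lpow N c s 0 = 0 := by
  rw [lpow, lre_zero, Real.zero_rpow hs, Complex.ofReal_zero]

/-- `Δ(p)^s Δ(p)^t = Δ(p)^{s+t}` off the zero mode. [folklore] -/
theorem lpow_mul_lpow {c : ℂ} (hc : c ≠ 0) (s t : ℝ) {p : Tor N} (hp : p ≠ 0) :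
    lpow N c s p * lpow N c t p = lpow N c (s + t) p := by
  rw [lpow, lpow, lpow, ← Complex.ofReal_mul, ← Real.rpow_add (lre_pos N hc hp)]

/-- `Δ(p)^s ≠ 0` off the zero mode. [folklore] -/
theorem lpow_ne_zero {c : ℂ} (hc : c ≠ 0) (s : ℝ) {p : Tor N} (hp : p ≠ 0) : lpow N c s p ≠ 0 := by
  rw [lpow, Ne, Complex.ofReal_eq_zero]
  exact (Real.rpow_pos_of_pos (lre_pos N hc hp) s).ne'

/-- `Δ(p)^1 = Δ(p)`. [folklore] -/
theorem lpow_one (c : ℂ) (p : Tor N) : lpow N c 1 p = lsym N c p := by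
  rw [lpow, Real.rpow_one, lsym_eq_lre]

/-- `Δ(p)^{-1} = Δ(p)⁻¹` — the symbol `linv` of the tree's `Δ⁻¹` (both are `0` at `p = 0`).
[folklore] -/
theorem lpow_neg_one (c : ℂ) (p : Tor N) : lpow N c (-1) p = (lsym N c p)⁻¹ := by
  rw [lpow, Real.rpow_neg_one, Complex.ofReal_inv, ← lsym_eq_lre]

/-- `Δ(p)^{-2} = Δ(p)⁻¹Δ(p)⁻¹` — the symbol of the tree's `Δ⁻² = Δ⁻¹Δ⁻¹`. [folklore] -/
theorem lpow_neg_two (c : ℂ) (p : Tor N) : lpow N c (-2) p = (lsym N c p)⁻¹ * (lsym N c p)⁻¹ := by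
  rw [lpow, Real.rpow_neg (lre_nonneg N c p), show (2 : ℝ) = ((2 : ℕ) : ℝ) by norm_num,
    Real.rpow_natCast, Complex.ofReal_inv, Complex.ofReal_pow, ← lsym_eq_lre, sq, mul_inv]

/-- **`Δ^s := U* diag(Δ(p)^s) U`** on scalar functions on the torus (a Fourier multiplier,
`B5Hk160Torus.sMul`). [cite: Balaban1984PropagatorsI, p.27 (1.51)] -/
def LapPowS (c : ℂ) (s : ℝ) : Matrix (Tor N) (Tor N) ℂ := sMul N (lpow N c s)

/-- `(Δ^s f)~(p) = Δ(p)^s f̃(p)`. [folklore] -/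
theorem dft_LapPowS (c : ℂ) (s : ℝ) (f : Tor N → ℂ) (p : Tor N) :
    (dft N *ᵥ (LapPowS N c s *ᵥ f)) p = lpow N c s p * (dft N *ᵥ f) p :=
  dft_sMul N _ f p

/-- the symbol calculus: `Δ^sΔ^t = Δ^{s+t}` whenever `s, t, s+t ≠ 0` (both sides kill the zero mode).
[folklore] -/
theorem LapPowS_LapPowS {c : ℂ} (hc : c ≠ 0) {s t : ℝ} (hs : s ≠ 0) (hst : s + t ≠ 0)
    (f : Tor N → ℂ) : LapPowS N c s *ᵥ (LapPowS N c t *ᵥ f) = LapPowS N c (s + t) *ᵥ f := by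
  refine dft_mulVec_injective N ?_
  funext p
  show (dft N *ᵥ (LapPowS N c s *ᵥ (LapPowS N c t *ᵥ f))) p = (dft N *ᵥ (LapPowS N c (s + t) *ᵥ f)) p
  rw [dft_LapPowS, dft_LapPowS, dft_LapPowS, ← mul_assoc]
  by_cases hp : p = 0
  · subst hp
    rw [lpow_zero_mode N c hs, lpow_zero_mode N c hst, zero_mul, zero_mul]
  · rw [lpow_mul_lpow N hc s t hp]

/-- `Δ^1 = Δ`. [folklore] -/
theorem LapPowS_one_mulVec (c : ℂ) (f : Tor N → ℂ) : LapPowS N c 1 *ᵥ f = LapS N c *ᵥ f := by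
  refine dft_mulVec_injective N ?_
  funext p
  show (dft N *ᵥ (LapPowS N c 1 *ᵥ f)) p = (dft N *ᵥ (LapS N c *ᵥ f)) p
  rw [dft_LapPowS, dft_LapS_apply, lpow_one]

/-- `Δ^{-1} =` the tree's `Δ⁻¹` (`B5LaplaceInverse.LapSinv`). [folklore] -/
theorem LapPowS_neg_one_mulVec (c : ℂ) (f : Tor N → ℂ) : LapPowS N c (-1) *ᵥ f = LapSinv N c *ᵥ f := by
  refine dft_mulVec_injective N ?_
  funext p
  show (dft N *ᵥ (LapPowS N c (-1) *ᵥ f)) p = (dft N *ᵥ (LapSinv N c *ᵥ f)) p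
  rw [dft_LapPowS, dft_LapSinv_apply, lpow_neg_one]

/-- `Δ^{-2} =` the tree's `Δ⁻² = Δ⁻¹Δ⁻¹`. [folklore] -/
theorem LapPowS_neg_two_mulVec (c : ℂ) (f : Tor N → ℂ) :
    LapPowS N c (-2) *ᵥ f = LapSinv N c *ᵥ (LapSinv N c *ᵥ f) := by
  refine dft_mulVec_injective N ?_
  funext p
  show (dft N *ᵥ (LapPowS N c (-2) *ᵥ f)) p = (dft N *ᵥ (LapSinv N c *ᵥ (LapSinv N c *ᵥ f))) p
  rw [dft_LapPowS, dft_LapSinv_apply, dft_LapSinv_apply, lpow_neg_two, mul_assoc]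

/-- `Δ^s f ⊥ 1` for `s ≠ 0` (no zero mode). [folklore] -/
theorem sum_LapPowS (c : ℂ) {s : ℝ} (hs : s ≠ 0) (f : Tor N → ℂ) : ∑ x, (LapPowS N c s *ᵥ f) x = 0 := by
  rw [sum_eq_zero_iff_dft_zero, dft_LapPowS, lpow_zero_mode N c hs, zero_mul]

/-- `Δ^s f = 0 ⇒ f̃(p) = 0` off the zero mode (`Δ^s` is injective on `{f ⊥ 1}`). [folklore] -/
theorem dft_eq_zero_of_LapPowS_eq_zero {c : ℂ} (hc : c ≠ 0) (s : ℝ) {f : Tor N → ℂ}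
    (h : LapPowS N c s *ᵥ f = 0) {p : Tor N} (hp : p ≠ 0) : (dft N *ᵥ f) p = 0 := by
  have h1 := congrFun (congrArg (fun g => dft N *ᵥ g) h) p
  simp only [dft_LapPowS, Matrix.mulVec_zero, Pi.zero_apply] at h1
  exact (mul_eq_zero.mp h1).resolve_left (lpow_ne_zero N hc s hp)

/-- the mean `|T|⁻¹ Σ_x f(x)` of a scalar function. [folklore] -/
def meanS (f : Tor N → ℂ) : ℂ := ((Fintype.card (Tor N) : ℂ))⁻¹ * ∑ x, f x

/-- `Δ⁻¹Δ f = f − (mean of f)` on the torus (`Δ⁻¹Δ = I − P_{ker}`, `B5LaplaceInverse.LapSinv_mul_LapS`).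
[cite: Balaban1984PropagatorsI, Sect. C p.22] -/
theorem LapSinv_LapS_eq {c : ℂ} (hc : c ≠ 0) (f : Tor N → ℂ) :
    LapSinv N c *ᵥ (LapS N c *ᵥ f) = f - fun _ => meanS N f := by
  have hT : (cT N : ℂ) ≠ 0 := by
    have h : (0 : ℝ) < cT N := by unfold cT; positivity
    exact_mod_cast h.ne'
  have hcard : ((Fintype.card (Tor N) : ℂ)) ≠ 0 := Nat.cast_ne_zero.mpr Fintype.card_ne_zero
  refine dft_mulVec_injective N ?_
  funext p
  show (dft N *ᵥ (LapSinv N c *ᵥ (LapS N c *ᵥ f))) p = (dft N *ᵥ (f - fun _ => meanS N f)) p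
  rw [dft_LapSinv_apply, dft_LapS_apply, Matrix.mulVec_sub, Pi.sub_apply]
  by_cases hp : p = 0
  · subst hp
    rw [lsym_zero, inv_zero, zero_mul, dft_zero_apply, dft_zero_apply, meanS]
    simp only [Finset.sum_const, Finset.card_univ, nsmul_eq_mul]
    rw [← mul_assoc (Fintype.card (Tor N) : ℂ), mul_inv_cancel₀ hcard, one_mul, sub_self]
  · have hl : lsym N c p ≠ 0 := fun h => hp ((lsym_eq_zero_iff N hc p).mp h)
    rw [← mul_assoc, inv_mul_cancel₀ hl, one_mul, dft_const_of_ne N _ hp, sub_zero]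

/-- `∂ f = 0 ⇒ f` is constant; with `f ⊥ 1` it vanishes. [folklore] -/
theorem eq_zero_of_GradOp_eq_zero {c : ℂ} (hc : c ≠ 0) {f : Tor N → ℂ} (h : GradOp N c *ᵥ f = 0)
    (hs : ∑ x, f x = 0) : f = 0 := by
  have hcst : ∀ x, f x = f 0 := fun x =>
    const_of_sdiff_eq_zero N hc f (fun ν => funext fun y => by
      rw [← GradOp_mulVec N c f y ν, h]; rfl) x
  have h0 : f 0 = 0 := by
    have hcard : ((Fintype.card (Tor N) : ℂ)) ≠ 0 := Nat.cast_ne_zero.mpr Fintype.card_ne_zero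
    simp only [hcst, Finset.sum_const, Finset.card_univ, nsmul_eq_mul] at hs
    exact (mul_eq_zero.mp hs).resolve_left hcard
  funext x
  rw [hcst, h0, Pi.zero_apply]

/-- `∂(const) = 0`. [folklore] -/
theorem GradOp_const (c a : ℂ) : GradOp N c *ᵥ (fun _ : Tor N => a) = 0 := by
  funext ⟨x, ν⟩
  rw [GradOp_mulVec, sdiff_const]
  rfl

end Scalar

variable (n : ℕ) [NeZero n] (M : Fin d → ℕ) [hM : ∀ μ, NeZero (M μ)]

/-- **`Δ^s` on vector fields on `T_η`**, componentwise (`B5Phi162Torus.liftV`).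
[cite: Balaban1984PropagatorsI, p.27 «A′ = Δ^{1/2}A», (1.51)–(1.54)] -/
def LapPowV (s : ℝ) : Matrix (Tor (fine n M) × Fin d) (Tor (fine n M) × Fin d) ℂ :=
  liftV (fine n M) fun _ => LapPowS (fine n M) (n : ℂ) s

/-- `(Δ^s A)_κ = Δ^s(A_κ)`. [folklore] -/
theorem comp_LapPowV_mulVec (s : ℝ) (A : Tor (fine n M) × Fin d → ℂ) (κ : Fin d) :
    comp (fine n M) (LapPowV n M s *ᵥ A) κ = LapPowS (fine n M) (n : ℂ) s *ᵥ comp (fine n M) A κ :=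
  comp_liftV_mulVec (fine n M) _ A κ

/-- `(Δ^s A)~_κ(p) = Δ(p)^s Ã_κ(p)`. [folklore] -/
theorem dft_comp_LapPowV (s : ℝ) (A : Tor (fine n M) × Fin d → ℂ) (κ : Fin d) (p : Tor (fine n M)) :
    (dft (fine n M) *ᵥ comp (fine n M) (LapPowV n M s *ᵥ A) κ) p
      = lpow (fine n M) (n : ℂ) s p * (dft (fine n M) *ᵥ comp (fine n M) A κ) p := by
  rw [comp_LapPowV_mulVec, dft_LapPowS]

/-- `Δ^sΔ^t = Δ^{s+t}` on vector fields (`s, s+t ≠ 0`). [folklore] -/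
theorem LapPowV_LapPowV {s t : ℝ} (hs : s ≠ 0) (hst : s + t ≠ 0) (A : Tor (fine n M) × Fin d → ℂ) :
    LapPowV n M s *ᵥ (LapPowV n M t *ᵥ A) = LapPowV n M (s + t) *ᵥ A := by
  have hnc : (n : ℂ) ≠ 0 := by exact_mod_cast NeZero.ne n
  refine eq_of_comp_eq (fine n M) fun κ => ?_
  rw [comp_LapPowV_mulVec, comp_LapPowV_mulVec, comp_LapPowV_mulVec,
    LapPowS_LapPowS (fine n M) hnc hs hst]

/-- `Δ^1 = Δ` on vector fields (`B5Prop11Lower.Lap`). [folklore] -/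
theorem LapPowV_one_mulVec (A : Tor (fine n M) × Fin d → ℂ) : LapPowV n M 1 *ᵥ A = Lap n M *ᵥ A := by
  refine eq_of_comp_eq (fine n M) fun κ => dft_mulVec_injective (fine n M) ?_
  funext p
  show (dft (fine n M) *ᵥ comp (fine n M) (LapPowV n M 1 *ᵥ A) κ) p
    = (dft (fine n M) *ᵥ comp (fine n M) (Lap n M *ᵥ A) κ) p
  rw [dft_comp_LapPowV, dft_comp_Lap, lpow_one]

/-- `Δ^{-1} =` the tree's `Δ⁻¹` on vector fields (`B5Phi162Torus.LapVinv`). [folklore] -/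
theorem LapPowV_neg_one_mulVec (A : Tor (fine n M) × Fin d → ℂ) :
    LapPowV n M (-1) *ᵥ A = LapVinv n M *ᵥ A := by
  refine eq_of_comp_eq (fine n M) fun κ => ?_
  rw [comp_LapPowV_mulVec, comp_LapVinv_mulVec, LapPowS_neg_one_mulVec]

/-- «dividing by Δ^{1/2}»: `Δ^{-1/2}Δ = Δ^{1/2}`. [cite: Balaban1984PropagatorsI, p.27 before (1.51)] -/
theorem LapPowV_negHalf_Lap (A : Tor (fine n M) × Fin d → ℂ) :
    LapPowV n M (-1 / 2) *ᵥ (Lap n M *ᵥ A) = LapPowV n M (1 / 2) *ᵥ A := by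
  rw [← LapPowV_one_mulVec, LapPowV_LapPowV n M (by norm_num) (by norm_num)]
  norm_num

/-- `Δ^s A ⊥ constants` for `s ≠ 0` («A′ is orthogonal to constant functions also»).
[cite: Balaban1984PropagatorsI, p.27 after (1.51)] -/
theorem orthConst_LapPowV {s : ℝ} (hs : s ≠ 0) (A : Tor (fine n M) × Fin d → ℂ) :
    OrthConst (fine n M) (LapPowV n M s *ᵥ A) :=
  orthConst_of_dft_comp_zero (fine n M) fun κ => by
    rw [dft_comp_LapPowV, lpow_zero_mode (fine n M) (n : ℂ) hs, zero_mul]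

/-- `Δ^s∂ = ∂Δ^s` (vector power on the left, scalar power on the right). [folklore] -/
theorem LapPowV_GradOp (s : ℝ) (f : Tor (fine n M) → ℂ) :
    LapPowV n M s *ᵥ (GradOp (fine n M) (n : ℂ) *ᵥ f)
      = GradOp (fine n M) (n : ℂ) *ᵥ (LapPowS (fine n M) (n : ℂ) s *ᵥ f) := by
  refine eq_of_comp_eq (fine n M) fun κ => dft_mulVec_injective (fine n M) ?_
  funext p
  show (dft (fine n M) *ᵥ comp (fine n M) (LapPowV n M s *ᵥ (GradOp (fine n M) (n : ℂ) *ᵥ f)) κ) p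
    = (dft (fine n M) *ᵥ comp (fine n M) (GradOp (fine n M) (n : ℂ) *ᵥ
        (LapPowS (fine n M) (n : ℂ) s *ᵥ f)) κ) p
  rw [dft_comp_LapPowV, dft_comp_GradOp, dft_comp_GradOp, dft_LapPowS]
  ring

/-- `∂*Δ^s = Δ^s∂*` (vector power inside, scalar power outside). [folklore] -/
theorem divS_LapPowV (s : ℝ) (V : Tor (fine n M) × Fin d → ℂ) :
    (GradOp (fine n M) (n : ℂ))ᴴ *ᵥ (LapPowV n M s *ᵥ V)
      = LapPowS (fine n M) (n : ℂ) s *ᵥ ((GradOp (fine n M) (n : ℂ))ᴴ *ᵥ V) := by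
  refine dft_mulVec_injective (fine n M) ?_
  funext p
  show (dft (fine n M) *ᵥ ((GradOp (fine n M) (n : ℂ))ᴴ *ᵥ (LapPowV n M s *ᵥ V))) p
    = (dft (fine n M) *ᵥ (LapPowS (fine n M) (n : ℂ) s *ᵥ ((GradOp (fine n M) (n : ℂ))ᴴ *ᵥ V))) p
  rw [dft_GradOp_adjoint, dft_LapPowS, dft_GradOp_adjoint, Finset.mul_sum]
  refine Finset.sum_congr rfl fun ν _ => ?_
  rw [dft_comp_LapPowV]
  ring

/-- «A = Δ^{-1/2}A′ + A₀, where A₀ is a constant configuration», `A′ = Δ^{1/2}A`: indeed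
`Δ^{-1/2}Δ^{1/2}A = A − A₀` with `A₀ = B5Hk160Torus.B0` the componentwise mean of `A`.
[cite: Balaban1984PropagatorsI, p.27 after (1.54)] -/
theorem LapPowV_negHalf_half (A : Tor (fine n M) × Fin d → ℂ) :
    LapPowV n M (-1 / 2) *ᵥ (LapPowV n M (1 / 2) *ᵥ A) = Bp (fine n M) A := by
  have hnc : (n : ℂ) ≠ 0 := by exact_mod_cast NeZero.ne n
  refine eq_of_comp_eq (fine n M) fun κ => dft_mulVec_injective (fine n M) ?_
  funext p
  show (dft (fine n M) *ᵥ comp (fine n M) (LapPowV n M (-1 / 2) *ᵥ (LapPowV n M (1 / 2) *ᵥ A)) κ) p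
    = (dft (fine n M) *ᵥ comp (fine n M) (Bp (fine n M) A) κ) p
  rw [dft_comp_LapPowV, dft_comp_LapPowV, ← mul_assoc]
  by_cases hp : p = 0
  · subst hp
    rw [lpow_zero_mode (fine n M) (n : ℂ) (by norm_num : (-1 / 2 : ℝ) ≠ 0), zero_mul, zero_mul,
      dft_comp_zero_of_orthConst (fine n M) (orthConst_Bp (fine n M) A) κ]
  · have hB : comp (fine n M) (Bp (fine n M) A) κ
        = comp (fine n M) A κ - fun _ => B0 (fine n M) A (0, κ) := by
      funext x
      rfl
    rw [lpow_mul_lpow (fine n M) hnc _ _ hp, show ((-1 / 2 : ℝ) + 1 / 2) = 0 by norm_num, lpow,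
      Real.rpow_zero, Complex.ofReal_one, one_mul, hB, Matrix.mulVec_sub, Pi.sub_apply,
      dft_const_of_ne (fine n M) _ hp, sub_zero]

/-! ## §2 The scalar products (1.21), the Lagrange function (1.48), its variations (1.49) -/

/-- the scalar product of VECTOR FIELDS ON `T_η` (1.21): `⟨u, v⟩ = η^d Σ_b ū(b)v(b)`, `η = n⁻¹`
on the double torus (`L = 1`). [cite: Balaban1984PropagatorsI, (1.21) p.21] -/
def ipF (u v : Tor (fine n M) × Fin d → ℂ) : ℂ := (((n : ℂ) ^ d))⁻¹ * (star u ⬝ᵥ v)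

/-- the scalar product of SCALAR FUNCTIONS ON `T_η` (1.21): `⟨u, v⟩ = η^d Σ_x ū(x)v(x)`
(`= B5Action121.ipw η^d u v`). [cite: Balaban1984PropagatorsI, (1.21) p.21] -/
def ipS (u v : Tor (fine n M) → ℂ) : ℂ := (((n : ℂ) ^ d))⁻¹ * (star u ⬝ᵥ v)

/-- the scalar product of vector fields on the UNIT LATTICE `T₁^{(k)}`: `⟨f, g⟩ = Σ_c f̄(c)g(c)`.
[cite: Balaban1984PropagatorsI, (1.21) p.21] -/
def ipC (f g : Tor M × Fin d → ℂ) : ℂ := star f ⬝ᵥ g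

/-- `Q_k* = QvAdj` IS THE ADJOINT for these scalar products: `⟨ω, Q_kA⟩_{T₁} = conj ⟨A, Q_k*ω⟩_{T_η}`
(`B5DeltaA169.QvAdj_adjoint`). [cite: Balaban1984PropagatorsI, (1.21) p.21, (1.49) p.26 `Q_k*ω`] -/
theorem ipC_QvOp (A : Tor (fine n M) × Fin d → ℂ) (ω : Tor M × Fin d → ℂ) :
    ipC M ω (QvOp n M *ᵥ A) = conj (ipF n M A (QvAdj n M *ᵥ ω)) := by
  rw [ipC, Matrix.star_dotProduct, QvAdj_adjoint, ipF, Complex.star_def]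

/-- `Δ − ∂∂*` is symmetric: `⟨A, (Δ − ∂∂*)A′⟩ = conj ⟨A′, (Δ − ∂∂*)A⟩`. [folklore] -/
theorem ipF_DstarD_symm (A A' : Tor (fine n M) × Fin d → ℂ) :
    ipF n M A (DstarD n M *ᵥ A') = conj (ipF n M A' (DstarD n M *ᵥ A)) := by
  rw [ipF, ipF, dotProduct_mulVec_eq_star_conjTranspose_mulVec, DstarD_conjTranspose,
    Matrix.star_dotProduct, Complex.star_def, map_mul, map_inv₀, map_pow, map_natCast]

/-- `R = I − P` is symmetric and `Rλ = λ`, `∂* = (∂)*`: `⟨λ, R∂*A′⟩ = conj ⟨A′, ∂λ⟩`.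
[cite: Balaban1984PropagatorsI, (1.48) p.26 «Rλ = λ», (1.28) p.22] -/
theorem ipS_R_divS (lam : Tor (fine n M) → ℂ) (hR : (1 - PcT n M (n : ℂ)) *ᵥ lam = lam)
    (A' : Tor (fine n M) × Fin d → ℂ) :
    ipS n M lam ((1 - PcT n M (n : ℂ)) *ᵥ ((GradOp (fine n M) (n : ℂ))ᴴ *ᵥ A'))
      = conj (ipF n M A' (GradOp (fine n M) (n : ℂ) *ᵥ lam)) := by
  rw [ipS, ipF, dotProduct_mulVec_eq_star_conjTranspose_mulVec, Matrix.conjTranspose_sub,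
    Matrix.conjTranspose_one, PcT_conjTranspose, hR, dotProduct_mulVec_eq_star_conjTranspose_mulVec,
    Matrix.conjTranspose_conjTranspose, Matrix.star_dotProduct, Complex.star_def, map_mul, map_inv₀,
    map_pow, map_natCast]

/-- **THE LAGRANGE FUNCTION (1.48)** «h(A, ω, λ) = ½⟨∂A, ∂A⟩ + ⟨ω, Q_kA − B⟩ + ⟨λ, R∂*A⟩
= ½⟨A, ΔA⟩ − ½⟨∂*A, ∂*A⟩ + ⟨ω, Q_kA − B⟩ + ⟨λ, R∂*A⟩», typed by its second expression with
`½⟨A, ΔA⟩ − ½⟨∂*A, ∂*A⟩ = ½⟨A, (Δ − ∂∂*)A⟩` (`e148b`), `Δ − ∂∂* = B5Hk163RDiv.DstarD`,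
`R = I − P = 1 − B5Value126.PcT` (1.28); real parts, since the tree's fields are complex-valued (for
the paper's real fields every term is real). [cite: Balaban1984PropagatorsI, (1.48) p.26] -/
def hLag (B : Tor M × Fin d → ℂ) (A : Tor (fine n M) × Fin d → ℂ) (ω : Tor M × Fin d → ℂ)
    (lam : Tor (fine n M) → ℂ) : ℝ :=
  1 / 2 * (ipF n M A (DstarD n M *ᵥ A)).re + (ipC M ω (QvOp n M *ᵥ A - B)).re
    + (ipS n M lam ((1 - PcT n M (n : ℂ)) *ᵥ ((GradOp (fine n M) (n : ℂ))ᴴ *ᵥ A))).re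

/-- (1.48), the two printed expressions agree: `⟨A, (Δ − ∂∂*)A⟩ = ⟨A, ΔA⟩ − ⟨∂*A, ∂*A⟩`.
[cite: Balaban1984PropagatorsI, (1.48) p.26] -/
theorem e148b (A : Tor (fine n M) × Fin d → ℂ) :
    ipF n M A (DstarD n M *ᵥ A)
      = ipF n M A (Lap n M *ᵥ A)
        - ipS n M ((GradOp (fine n M) (n : ℂ))ᴴ *ᵥ A) ((GradOp (fine n M) (n : ℂ))ᴴ *ᵥ A) := by
  rw [ipF, ipF, ipS, DstarD, Matrix.sub_mulVec, dotProduct_sub, ← Matrix.mulVec_mulVec,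
    dotProduct_mulVec_eq_star_conjTranspose_mulVec (GradOp (fine n M) (n : ℂ)) A, mul_sub]

/-- (1.48), first expression: `⟨A, (Δ − ∂∂*)A⟩ = ⟨∂A, ∂A⟩ = η^d · ½Σ_{x,μ,ν}|F_{μν}(x)|²`
(`B5Hk163RDiv.form_DstarD`, (1.69) `Δ = ∂*∂ + ∂∂*`); in particular the energy term of `h` is
`η^d/2 · cEnergy A`. [cite: Balaban1984PropagatorsI, (1.48) p.26, (1.21) p.21, (1.69) p.29] -/
theorem e148a (A : Tor (fine n M) × Fin d → ℂ) :
    ipF n M A (DstarD n M *ᵥ A)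
      = (((n : ℂ) ^ d))⁻¹ * ((((1 / 2 : ℝ) * ∑ x, ∑ μ, ∑ ν, ‖Fs (fine n M) (n : ℂ) A μ ν x‖ ^ 2 : ℝ)) : ℂ)
    ∧ (ipF n M A (DstarD n M *ᵥ A)).re = ((n : ℝ) ^ d)⁻¹ * cEnergy n M A := by
  refine ⟨by rw [ipF, form_DstarD], ?_⟩
  rw [ipF, cEnergy, show (((n : ℂ) ^ d))⁻¹ = ((((n : ℝ) ^ d)⁻¹ : ℝ) : ℂ) by push_cast; rfl,
    Complex.re_ofReal_mul]

/-- **δh/δA (1.49)**: the exact expansion of `h` in `A` — linear part `⟨A′, ΔA − ∂∂*A + Q_k*ω + ∂λ⟩`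
(so «δh/δA = ΔA − ∂∂*A + Q_k*ω + ∂λ»), quadratic part `½⟨A′, (Δ − ∂∂*)A′⟩`; uses `Rλ = λ`.
[cite: Balaban1984PropagatorsI, (1.49) p.26] -/
theorem hLag_add_A (B : Tor M × Fin d → ℂ) (A A' : Tor (fine n M) × Fin d → ℂ) (ω : Tor M × Fin d → ℂ)
    (lam : Tor (fine n M) → ℂ) (hR : (1 - PcT n M (n : ℂ)) *ᵥ lam = lam) :
    hLag n M B (A + A') ω lam
      = hLag n M B A ω lam
        + (ipF n M A' (DstarD n M *ᵥ A + QvAdj n M *ᵥ ω + GradOp (fine n M) (n : ℂ) *ᵥ lam)).re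
        + 1 / 2 * (ipF n M A' (DstarD n M *ᵥ A')).re := by
  have h1 : (ipF n M A (DstarD n M *ᵥ A')).re = (ipF n M A' (DstarD n M *ᵥ A)).re := by
    rw [ipF_DstarD_symm, Complex.conj_re]
  have h2 : (ipC M ω (QvOp n M *ᵥ A')).re = (ipF n M A' (QvAdj n M *ᵥ ω)).re := by
    rw [ipC_QvOp, Complex.conj_re]
  have h3 : (ipS n M lam ((1 - PcT n M (n : ℂ)) *ᵥ ((GradOp (fine n M) (n : ℂ))ᴴ *ᵥ A'))).re
      = (ipF n M A' (GradOp (fine n M) (n : ℂ) *ᵥ lam)).re := by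
    rw [ipS_R_divS n M lam hR, Complex.conj_re]
  have e1 : QvOp n M *ᵥ (A + A') - B = (QvOp n M *ᵥ A - B) + QvOp n M *ᵥ A' := by
    rw [Matrix.mulVec_add]; abel
  unfold hLag
  rw [e1]
  simp only [ipF, ipC, ipS, Matrix.mulVec_add, dotProduct_add, star_add, add_dotProduct, mul_add,
    Complex.add_re] at h1 h2 h3 ⊢
  linarith

/-- **δh/δω (1.49)**: `h(A, ω + ω′, λ) = h(A, ω, λ) + ⟨ω′, Q_kA − B⟩` (so «δh/δω = Q_kA − B»).
[cite: Balaban1984PropagatorsI, (1.49) p.26] -/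
theorem hLag_add_omega (B : Tor M × Fin d → ℂ) (A : Tor (fine n M) × Fin d → ℂ) (ω ω' : Tor M × Fin d → ℂ)
    (lam : Tor (fine n M) → ℂ) :
    hLag n M B A (ω + ω') lam = hLag n M B A ω lam + (ipC M ω' (QvOp n M *ᵥ A - B)).re := by
  unfold hLag
  simp only [ipC, star_add, add_dotProduct, Complex.add_re]
  ring

/-- **δh/δλ (1.49)**: `h(A, ω, λ + λ′) = h(A, ω, λ) + ⟨λ′, R∂*A⟩` (so «δh/δλ = R∂*A»).
[cite: Balaban1984PropagatorsI, (1.49) p.26] -/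
theorem hLag_add_lam (B : Tor M × Fin d → ℂ) (A : Tor (fine n M) × Fin d → ℂ) (ω : Tor M × Fin d → ℂ)
    (lam lam' : Tor (fine n M) → ℂ) :
    hLag n M B A ω (lam + lam')
      = hLag n M B A ω lam
        + (ipS n M lam' ((1 - PcT n M (n : ℂ)) *ᵥ ((GradOp (fine n M) (n : ℂ))ᴴ *ᵥ A))).re := by
  unfold hLag
  simp only [ipS, star_add, add_dotProduct, mul_add, Complex.add_re]
  ring

/-- a vector paired against itself: `r·⟨G, G⟩` has real part `0` only for `G = 0` (`r > 0`) — so a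
linear form `A′ ↦ Re r⟨A′, G⟩` vanishes identically iff `G = 0`, which is how the displayed
variations (1.49) are read off the expansions above. [folklore] -/
theorem eq_zero_of_re_form {ι : Type*} [Fintype ι] {r : ℝ} (hr : 0 < r) (G : ι → ℂ)
    (h : (((r : ℂ)) * (star G ⬝ᵥ G)).re = 0) : G = 0 := by
  have hS : star G ⬝ᵥ G = ((∑ i, Complex.normSq (G i) : ℝ) : ℂ) := by
    rw [Complex.ofReal_sum]
    simp only [dotProduct, Pi.star_apply, Complex.star_def, Complex.normSq_eq_conj_mul_self]
  rw [hS, ← Complex.ofReal_mul, Complex.ofReal_re] at h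
  have h0 : ∑ i, Complex.normSq (G i) = 0 := by
    rcases mul_eq_zero.mp h with h | h
    · exact absurd h hr.ne'
    · exact h
  funext i
  exact Complex.normSq_eq_zero.mp
    ((Finset.sum_eq_zero_iff_of_nonneg fun j _ => Complex.normSq_nonneg _).mp h0 i (Finset.mem_univ i))

/-- **THE LAGRANGE SYSTEM (1.49)** «δh/δA = ΔA − ∂∂*A + Q_k*ω + ∂λ = 0, δh/δω = Q_kA − B = 0,
δh/δλ = R∂*A = 0» as a proposition about `(A, ω, λ)` for the datum `B`.
[cite: Balaban1984PropagatorsI, (1.49) p.26] -/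
def EL149 (B : Tor M × Fin d → ℂ) (A : Tor (fine n M) × Fin d → ℂ) (ω : Tor M × Fin d → ℂ)
    (lam : Tor (fine n M) → ℂ) : Prop :=
  Lap n M *ᵥ A - GradOp (fine n M) (n : ℂ) *ᵥ ((GradOp (fine n M) (n : ℂ))ᴴ *ᵥ A) + QvAdj n M *ᵥ ω
      + GradOp (fine n M) (n : ℂ) *ᵥ lam = 0
  ∧ QvOp n M *ᵥ A - B = 0
  ∧ (1 - PcT n M (n : ℂ)) *ᵥ ((GradOp (fine n M) (n : ℂ))ᴴ *ᵥ A) = 0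

/-- `ΔA − ∂∂*A = (Δ − ∂∂*)A` (`B5Hk163RDiv.DstarD`). [folklore] -/
theorem Lap_sub_GradDiv (A : Tor (fine n M) × Fin d → ℂ) :
    Lap n M *ᵥ A - GradOp (fine n M) (n : ℂ) *ᵥ ((GradOp (fine n M) (n : ℂ))ᴴ *ᵥ A) = DstarD n M *ᵥ A := by
  rw [DstarD, Matrix.sub_mulVec, Matrix.mulVec_mulVec]

/-- **(1.49) ⟺ `h` IS STATIONARY** (with `Rλ = λ`): the three linear parts of the expansions vanish
identically iff the three displayed equations hold. [cite: Balaban1984PropagatorsI, (1.49) p.26] -/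
theorem el149_iff_stationary (B : Tor M × Fin d → ℂ) (A : Tor (fine n M) × Fin d → ℂ) (ω : Tor M × Fin d → ℂ)
    (lam : Tor (fine n M) → ℂ) :
    EL149 n M B A ω lam ↔
      (∀ A', (ipF n M A' (DstarD n M *ᵥ A + QvAdj n M *ᵥ ω + GradOp (fine n M) (n : ℂ) *ᵥ lam)).re = 0)
      ∧ (∀ ω', (ipC M ω' (QvOp n M *ᵥ A - B)).re = 0)
      ∧ (∀ lam', (ipS n M lam' ((1 - PcT n M (n : ℂ)) *ᵥ ((GradOp (fine n M) (n : ℂ))ᴴ *ᵥ A))).re = 0) := by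
  have hr : (0 : ℝ) < ((n : ℝ) ^ d)⁻¹ := by
    have hn : (0 : ℝ) < n := by exact_mod_cast Nat.pos_of_ne_zero (NeZero.ne n)
    positivity
  have hcast : (((n : ℂ) ^ d))⁻¹ = ((((n : ℝ) ^ d)⁻¹ : ℝ) : ℂ) := by push_cast; rfl
  unfold EL149
  rw [Lap_sub_GradDiv]
  constructor
  · rintro ⟨h1, h2, h3⟩
    refine ⟨fun A' => ?_, fun ω' => ?_, fun lam' => ?_⟩
    · rw [h1, ipF, dotProduct_zero, mul_zero, Complex.zero_re]
    · rw [h2, ipC, dotProduct_zero, Complex.zero_re]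
    · rw [h3, ipS, dotProduct_zero, mul_zero, Complex.zero_re]
  · rintro ⟨h1, h2, h3⟩
    refine ⟨?_, ?_, ?_⟩
    · have h := h1 (DstarD n M *ᵥ A + QvAdj n M *ᵥ ω + GradOp (fine n M) (n : ℂ) *ᵥ lam)
      rw [ipF, hcast] at h
      exact eq_zero_of_re_form hr _ h
    · have h := h2 (QvOp n M *ᵥ A - B)
      rw [ipC, ← one_mul (star _ ⬝ᵥ _), ← Complex.ofReal_one] at h
      exact eq_zero_of_re_form one_pos _ h
    · have h := h3 ((1 - PcT n M (n : ℂ)) *ᵥ ((GradOp (fine n M) (n : ℂ))ᴴ *ᵥ A))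
      rw [ipS, hcast] at h
      exact eq_zero_of_re_form hr _ h

/-- **SUFFICIENCY OF (1.49) — the Lagrange principle**: a solution `(A, ω, λ)` of (1.49) with
`Rλ = λ` MINIMISES «the form ½⟨∂A, ∂A⟩ under the conditions Q_kA = B, R∂*A = 0» (directly from the
expansion `hLag_add_A`: on the hyperplane the linear part is `−⟨Q_kA′, ω⟩ − ⟨R∂*A′, λ⟩ = 0`).
[cite: Balaban1984PropagatorsI, p.26 before (1.48)] -/
theorem cEnergy_le_of_el149 {B : Tor M × Fin d → ℂ} {A : Tor (fine n M) × Fin d → ℂ} {ω : Tor M × Fin d → ℂ}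
    {lam : Tor (fine n M) → ℂ} (hR : (1 - PcT n M (n : ℂ)) *ᵥ lam = lam) (h : EL149 n M B A ω lam)
    (A₁ : Tor (fine n M) × Fin d → ℂ) (hA₁ : QvOp n M *ᵥ A₁ = B)
    (hR₁ : (1 - PcT n M (n : ℂ)) *ᵥ ((GradOp (fine n M) (n : ℂ))ᴴ *ᵥ A₁) = 0) :
    cEnergy n M A ≤ cEnergy n M A₁ := by
  have hnd : (((n : ℂ) ^ d))⁻¹ ≠ 0 := inv_ne_zero (pow_ne_zero _ (by exact_mod_cast NeZero.ne n))
  have hr : (0 : ℝ) < ((n : ℝ) ^ d)⁻¹ := by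
    have hn : (0 : ℝ) < n := by exact_mod_cast Nat.pos_of_ne_zero (NeZero.ne n)
    positivity
  obtain ⟨h1, h2, h3⟩ := h
  rw [Lap_sub_GradDiv] at h1
  set A' := A₁ - A with hA'
  have hQ : QvOp n M *ᵥ A' = 0 := by
    rw [hA', Matrix.mulVec_sub, hA₁, ← sub_eq_zero.mp h2, sub_self]
  have hRA' : (1 - PcT n M (n : ℂ)) *ᵥ ((GradOp (fine n M) (n : ℂ))ᴴ *ᵥ A') = 0 := by
    rw [hA', Matrix.mulVec_sub, Matrix.mulVec_sub, hR₁, h3, sub_self]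
  -- the linear part vanishes on the hyperplane `{Q_kA′ = 0, R∂*A′ = 0}`
  have e : DstarD n M *ᵥ A = -(QvAdj n M *ᵥ ω + GradOp (fine n M) (n : ℂ) *ᵥ lam) := by
    rw [eq_neg_iff_add_eq_zero, ← add_assoc, h1]
  have hω : star A' ⬝ᵥ (QvAdj n M *ᵥ ω) = 0 := by
    have h := ipC_QvOp n M A' ω
    rw [hQ, ipC, dotProduct_zero] at h
    have h' := congrArg conj h
    rw [map_zero, Complex.conj_conj, ipF] at h'
    exact (mul_eq_zero.mp h'.symm).resolve_left hnd
  have hl : star A' ⬝ᵥ (GradOp (fine n M) (n : ℂ) *ᵥ lam) = 0 := by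
    have h := ipS_R_divS n M lam hR A'
    rw [hRA', ipS, dotProduct_zero, mul_zero] at h
    have h' := congrArg conj h
    rw [map_zero, Complex.conj_conj, ipF] at h'
    exact (mul_eq_zero.mp h'.symm).resolve_left hnd
  have hcross : star A' ⬝ᵥ (DstarD n M *ᵥ A) = 0 := by
    rw [e, dotProduct_neg, dotProduct_add, hω, hl, add_zero, neg_zero]
  have hcross' : star A ⬝ᵥ (DstarD n M *ᵥ A') = 0 := by
    rw [dotProduct_mulVec_eq_star_conjTranspose_mulVec, DstarD_conjTranspose, Matrix.star_dotProduct,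
      hcross, star_zero]
  have hexp : cEnergy n M A₁ = cEnergy n M A + cEnergy n M A' := by
    have hA₁' : A₁ = A + A' := by rw [hA']; abel
    rw [cEnergy, cEnergy, cEnergy, hA₁', Matrix.mulVec_add, star_add, add_dotProduct, dotProduct_add,
      dotProduct_add, hcross, hcross', add_zero, zero_add, Complex.add_re]
  rw [hexp]
  exact le_add_of_nonneg_right (cEnergy_nonneg n M A')

/-! ## §3 (1.50)–(1.54): from the Lagrange system to the decomposition of `A′ = Δ^{1/2}A` -/

/-- three symbol-calculus instances used below: `Δ^{-1/2}Δ⁻¹ = Δ^{-3/2}`. [folklore] -/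
theorem negHalf_LapSinv (v : Tor (fine n M) → ℂ) :
    LapPowS (fine n M) (n : ℂ) (-1 / 2) *ᵥ (LapSinv (fine n M) (n : ℂ) *ᵥ v)
      = LapPowS (fine n M) (n : ℂ) (-3 / 2) *ᵥ v := by
  have hnc : (n : ℂ) ≠ 0 := by exact_mod_cast NeZero.ne n
  rw [← LapPowS_neg_one_mulVec,
    LapPowS_LapPowS (fine n M) hnc (s := -1 / 2) (t := -1) (by norm_num) (by norm_num)]
  norm_num

/-- `Δ⁻¹ = Δ^{-3/2}Δ^{1/2}`. [folklore] -/
theorem LapSinv_eq_m32_half (v : Tor (fine n M) → ℂ) :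
    LapSinv (fine n M) (n : ℂ) *ᵥ v
      = LapPowS (fine n M) (n : ℂ) (-3 / 2) *ᵥ (LapPowS (fine n M) (n : ℂ) (1 / 2) *ᵥ v) := by
  have hnc : (n : ℂ) ≠ 0 := by exact_mod_cast NeZero.ne n
  rw [← LapPowS_neg_one_mulVec,
    LapPowS_LapPowS (fine n M) hnc (s := -3 / 2) (t := 1 / 2) (by norm_num) (by norm_num)]
  norm_num

/-- `Δ^{-3/2}ΔΔ^{-3/2} = Δ⁻²`. [folklore] -/
theorem m32_LapS_m32 (f : Tor (fine n M) → ℂ) :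
    LapPowS (fine n M) (n : ℂ) (-3 / 2) *ᵥ (LapS (fine n M) (n : ℂ) *ᵥ
        (LapPowS (fine n M) (n : ℂ) (-3 / 2) *ᵥ f))
      = LapSinv (fine n M) (n : ℂ) *ᵥ (LapSinv (fine n M) (n : ℂ) *ᵥ f) := by
  have hnc : (n : ℂ) ≠ 0 := by exact_mod_cast NeZero.ne n
  rw [← LapPowS_one_mulVec,
    LapPowS_LapPowS (fine n M) hnc (s := 1) (t := -3 / 2) (by norm_num) (by norm_num),
    LapPowS_LapPowS (fine n M) hnc (s := -3 / 2) (t := 1 + -3 / 2) (by norm_num) (by norm_num),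
    ← LapPowS_neg_two_mulVec]
  norm_num

/-- `Δ^{-3/2}Δ^{-1/2}Δ = Δ⁻¹`. [folklore] -/
theorem m32_mhalf_LapS (f : Tor (fine n M) → ℂ) :
    LapPowS (fine n M) (n : ℂ) (-3 / 2) *ᵥ (LapPowS (fine n M) (n : ℂ) (-1 / 2) *ᵥ
        (LapS (fine n M) (n : ℂ) *ᵥ f))
      = LapSinv (fine n M) (n : ℂ) *ᵥ f := by
  have hnc : (n : ℂ) ≠ 0 := by exact_mod_cast NeZero.ne n
  rw [← LapPowS_one_mulVec,
    LapPowS_LapPowS (fine n M) hnc (s := -1 / 2) (t := 1) (by norm_num) (by norm_num),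
    LapPowS_LapPowS (fine n M) hnc (s := -3 / 2) (t := -1 / 2 + 1) (by norm_num) (by norm_num),
    ← LapPowS_neg_one_mulVec]
  norm_num

/-- `Δ^{-3/2}Δ^{-1/2} = Δ⁻²` and `Δ^{-1/2}Δ^{-3/2} = Δ⁻²`. [folklore] -/
theorem m32_mhalf (f : Tor (fine n M) → ℂ) :
    LapPowS (fine n M) (n : ℂ) (-3 / 2) *ᵥ (LapPowS (fine n M) (n : ℂ) (-1 / 2) *ᵥ f)
      = LapSinv (fine n M) (n : ℂ) *ᵥ (LapSinv (fine n M) (n : ℂ) *ᵥ f)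
    ∧ LapPowS (fine n M) (n : ℂ) (-1 / 2) *ᵥ (LapPowS (fine n M) (n : ℂ) (-3 / 2) *ᵥ f)
      = LapSinv (fine n M) (n : ℂ) *ᵥ (LapSinv (fine n M) (n : ℂ) *ᵥ f) := by
  have hnc : (n : ℂ) ≠ 0 := by exact_mod_cast NeZero.ne n
  constructor
  · rw [LapPowS_LapPowS (fine n M) hnc (s := -3 / 2) (t := -1 / 2) (by norm_num) (by norm_num),
      ← LapPowS_neg_two_mulVec]
    norm_num
  · rw [LapPowS_LapPowS (fine n M) hnc (s := -1 / 2) (t := -3 / 2) (by norm_num) (by norm_num),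
      ← LapPowS_neg_two_mulVec]
    norm_num

/-- `Δ^{-1/2}Δ^{-1/2} = Δ⁻¹` on vector fields. [folklore] -/
theorem negHalf_negHalf (V : Tor (fine n M) × Fin d → ℂ) :
    LapPowV n M (-1 / 2) *ᵥ (LapPowV n M (-1 / 2) *ᵥ V) = LapVinv n M *ᵥ V := by
  rw [LapPowV_LapPowV n M (s := -1 / 2) (t := -1 / 2) (by norm_num) (by norm_num),
    ← LapPowV_neg_one_mulVec]
  norm_num

/-- the displayed form of the gauge condition: «R∂*A = ∂*A − Δ⁻¹Q′_k*(Q′_kΔ⁻²Q′_k*)⁻¹Q′_kΔ⁻¹∂*A»,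
`Q′_k*(Q′_kΔ⁻²Q′_k*)⁻¹ = B5Hk160Torus.QsAdj ∘ B5Hk160Torus.Einv` (the weights `η^{±d}` cancel,
`QsAdj_Einv`). [cite: Balaban1984PropagatorsI, p.26 before (1.50), (1.28) p.22] -/
theorem R_mulVec (v : Tor (fine n M) → ℂ) :
    (1 - PcT n M (n : ℂ)) *ᵥ v
      = v - LapSinv (fine n M) (n : ℂ) *ᵥ (QsAdj n M *ᵥ (Einv n M *ᵥ (QsOp n M *ᵥ
          (LapSinv (fine n M) (n : ℂ) *ᵥ v)))) := by
  rw [Matrix.sub_mulVec, Matrix.one_mulVec, PcT_mulVec, QsAdj_Einv]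

/-- **(1.50)** «so the first equation has the form
ΔA − ∂Δ⁻¹Q′_k*(Q′_kΔ⁻²Q′_k*)⁻¹Q′_kΔ⁻¹∂*A + Q_k*ω + ∂λ = 0» — from the first and third equations of
(1.49). [cite: Balaban1984PropagatorsI, (1.50) p.26] -/
theorem e150 {B : Tor M × Fin d → ℂ} {A : Tor (fine n M) × Fin d → ℂ} {ω : Tor M × Fin d → ℂ}
    {lam : Tor (fine n M) → ℂ} (h : EL149 n M B A ω lam) :
    Lap n M *ᵥ A
        - GradOp (fine n M) (n : ℂ) *ᵥ (LapSinv (fine n M) (n : ℂ) *ᵥ (QsAdj n M *ᵥ (Einv n M *ᵥ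
            (QsOp n M *ᵥ (LapSinv (fine n M) (n : ℂ) *ᵥ ((GradOp (fine n M) (n : ℂ))ᴴ *ᵥ A))))))
        + QvAdj n M *ᵥ ω + GradOp (fine n M) (n : ℂ) *ᵥ lam = 0 := by
  obtain ⟨h1, -, h3⟩ := h
  have e : (GradOp (fine n M) (n : ℂ))ᴴ *ᵥ A
      = LapSinv (fine n M) (n : ℂ) *ᵥ (QsAdj n M *ᵥ (Einv n M *ᵥ (QsOp n M *ᵥ
          (LapSinv (fine n M) (n : ℂ) *ᵥ ((GradOp (fine n M) (n : ℂ))ᴴ *ᵥ A))))) := by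
    rw [R_mulVec, sub_eq_zero] at h3
    exact h3
  rw [← e]
  exact h1

/-- `Σ_x (Q_k*ω)_κ(x) = η^{-d} Σ_y ω_κ(y)` — the constant mode of `Q_k*ω` is that of `ω`
(adjointness against the constant configuration `e_κ`). [folklore] -/
theorem star_constV_single_dotProduct (N : Fin d → ℕ) [∀ ν, NeZero (N ν)] (κ : Fin d)
    (V : Tor N × Fin d → ℂ) : star (constV N (Pi.single κ (1 : ℂ))) ⬝ᵥ V = ∑ x, V (x, κ) := by
  simp only [dotProduct, Fintype.sum_prod_type, Pi.star_apply, constV, Pi.single_apply]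
  simp only [apply_ite (star : ℂ → ℂ), star_one, star_zero, ite_mul, one_mul, zero_mul,
    Finset.sum_ite_eq', Finset.mem_univ, if_true]

/-- `Σ_x (Q_k*ω)_κ(x) = η^{-d} Σ_y ω_κ(y)`. [folklore] -/
theorem sum_comp_QvAdj (ω : Tor M × Fin d → ℂ) (κ : Fin d) :
    ∑ x, (QvAdj n M *ᵥ ω) (x, κ) = (n : ℂ) ^ d * ∑ y, ω (y, κ) := by
  have hnd : ((n : ℂ) ^ d) ≠ 0 := pow_ne_zero _ (by exact_mod_cast NeZero.ne n)
  have h := QvAdj_adjoint n M (constV (fine n M) (Pi.single κ 1)) ω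
  rw [QvOp_constV, star_constV_single_dotProduct, star_constV_single_dotProduct] at h
  rw [h, ← mul_assoc, mul_inv_cancel₀ hnd, one_mul]

/-- **«It implies that ω is orthogonal to constant functions»** — sum (1.50) (equivalently the first
equation of (1.49)) over `T_η`: `ΔA`, `∂(…)` and `∂λ` have no constant mode.
[cite: Balaban1984PropagatorsI, p.27 l.1] -/
theorem orthConst_omega {B : Tor M × Fin d → ℂ} {A : Tor (fine n M) × Fin d → ℂ} {ω : Tor M × Fin d → ℂ}
    {lam : Tor (fine n M) → ℂ} (h : EL149 n M B A ω lam) : OrthConst M ω := by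
  have hnd : ((n : ℂ) ^ d) ≠ 0 := pow_ne_zero _ (by exact_mod_cast NeZero.ne n)
  obtain ⟨h1, -, -⟩ := h
  have hL : OrthConst (fine n M) (Lap n M *ᵥ A) :=
    orthConst_of_dft_comp_zero (fine n M) fun κ => by rw [dft_comp_Lap, lsym_zero, zero_mul]
  have e : QvAdj n M *ᵥ ω
      = -(Lap n M *ᵥ A) + GradOp (fine n M) (n : ℂ) *ᵥ ((GradOp (fine n M) (n : ℂ))ᴴ *ᵥ A)
        - GradOp (fine n M) (n : ℂ) *ᵥ lam := by
    rw [← sub_eq_zero, ← h1]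
    abel
  intro κ
  have hs : ∑ x, (QvAdj n M *ᵥ ω) (x, κ) = 0 := by
    simp only [e, Pi.sub_apply, Pi.add_apply, Pi.neg_apply, Finset.sum_sub_distrib,
      Finset.sum_add_distrib, Finset.sum_neg_distrib]
    rw [hL κ, orthConst_GradOp (fine n M) (n : ℂ) _ κ, orthConst_GradOp (fine n M) (n : ℂ) lam κ]
    ring
  rw [sum_comp_QvAdj] at hs
  exact (mul_eq_zero.mp hs).resolve_left hnd

/-- «the new variables A′ = Δ^{1/2}A». [cite: Balaban1984PropagatorsI, p.27 before (1.51)] -/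
def Ap (A : Tor (fine n M) × Fin d → ℂ) : Tor (fine n M) × Fin d → ℂ := LapPowV n M (1 / 2) *ᵥ A

/-- «Let us notice that A′ is orthogonal to constant functions also». [cite: Balaban1984PropagatorsI, p.27] -/
theorem orthConst_Ap (A : Tor (fine n M) × Fin d → ℂ) : OrthConst (fine n M) (Ap n M A) :=
  orthConst_LapPowV n M (by norm_num) A

/-- «A = Δ^{-1/2}A′ + A₀, where A₀ is a constant configuration» — on the torus `A₀ = B5Hk160Torus.B0`
(the componentwise mean of `A`), an IDENTITY. [cite: Balaban1984PropagatorsI, p.27 after (1.54)] -/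
theorem A_decomp (A : Tor (fine n M) × Fin d → ℂ) :
    A = LapPowV n M (-1 / 2) *ᵥ Ap n M A + B0 (fine n M) A := by
  rw [Ap, LapPowV_negHalf_half]
  exact (Bp_add_B0 (fine n M) A).symm

/-- **(1.51)** «A′ − ∂Δ^{-3/2}Q′_k*(Q′_kΔ⁻²Q′_k*)⁻¹Q′_kΔ^{-3/2}∂*A′ + Δ^{-1/2}Q_k*ω + Δ^{-1/2}∂λ = 0»
— (1.50) «divided by Δ^{1/2}» (i.e. multiplied by `Δ^{-1/2}`), in the variables `A′ = Δ^{1/2}A`.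
[cite: Balaban1984PropagatorsI, (1.51) p.27] -/
theorem e151 {B : Tor M × Fin d → ℂ} {A : Tor (fine n M) × Fin d → ℂ} {ω : Tor M × Fin d → ℂ}
    {lam : Tor (fine n M) → ℂ} (h : EL149 n M B A ω lam) :
    Ap n M A
        - GradOp (fine n M) (n : ℂ) *ᵥ (LapPowS (fine n M) (n : ℂ) (-3 / 2) *ᵥ (QsAdj n M *ᵥ
            (Einv n M *ᵥ (QsOp n M *ᵥ (LapPowS (fine n M) (n : ℂ) (-3 / 2) *ᵥ
              ((GradOp (fine n M) (n : ℂ))ᴴ *ᵥ Ap n M A))))))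
        + LapPowV n M (-1 / 2) *ᵥ (QvAdj n M *ᵥ ω)
        + LapPowV n M (-1 / 2) *ᵥ (GradOp (fine n M) (n : ℂ) *ᵥ lam) = 0 := by
  have key := congrArg (fun v => LapPowV n M (-1 / 2) *ᵥ v) (e150 n M h)
  simp only [Matrix.mulVec_add, Matrix.mulVec_sub, Matrix.mulVec_zero] at key
  rw [LapPowV_negHalf_Lap, LapPowV_GradOp, negHalf_LapSinv, LapSinv_eq_m32_half n M ((GradOp _ _)ᴴ *ᵥ A),
    ← divS_LapPowV] at key
  rw [Ap]
  exact key

/-- the operator `P` of (1.52): `P := ∂Δ^{-3/2}Q′_k*(Q′_kΔ⁻²Q′_k*)⁻¹Q′_kΔ^{-3/2}∂*` (so that (1.51)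
reads `(I − P)A′ + … = 0`); a projection (`Pv_mulVec_Pv`). [cite: Balaban1984PropagatorsI, (1.52) p.27] -/
def Pv : Matrix (Tor (fine n M) × Fin d) (Tor (fine n M) × Fin d) ℂ :=
  GradOp (fine n M) (n : ℂ) * LapPowS (fine n M) (n : ℂ) (-3 / 2) * QsAdj n M * Einv n M * QsOp n M
    * LapPowS (fine n M) (n : ℂ) (-3 / 2) * (GradOp (fine n M) (n : ℂ))ᴴ

/-- `P v = ∂Δ^{-3/2}Q′_k*(Q′_kΔ⁻²Q′_k*)⁻¹Q′_kΔ^{-3/2}∂*v`. [folklore] -/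
theorem Pv_mulVec (v : Tor (fine n M) × Fin d → ℂ) :
    Pv n M *ᵥ v
      = GradOp (fine n M) (n : ℂ) *ᵥ (LapPowS (fine n M) (n : ℂ) (-3 / 2) *ᵥ (QsAdj n M *ᵥ
          (Einv n M *ᵥ (QsOp n M *ᵥ (LapPowS (fine n M) (n : ℂ) (-3 / 2) *ᵥ
            ((GradOp (fine n M) (n : ℂ))ᴴ *ᵥ v)))))) := by
  simp only [Pv, ← Matrix.mulVec_mulVec]

/-- `λ′`-type coarse fields `Q′_kΔ^{-3/2}∂*v` are `⊥ 1`. [folklore] -/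
theorem sum_QsOp_m32 (v : Tor (fine n M) × Fin d → ℂ) :
    ∑ y, (QsOp n M *ᵥ (LapPowS (fine n M) (n : ℂ) (-3 / 2) *ᵥ ((GradOp (fine n M) (n : ℂ))ᴴ *ᵥ v))) y
      = 0 :=
  QsOp_orth n M _ (sum_LapPowS (fine n M) (n : ℂ) (by norm_num) _)

/-- **`P² = P`** — `P` is a projection (as the notation `(I − P)A′`, `PA′` of (1.52)–(1.54) presumes):
`∂*∂ = Δ`, `Δ^{-3/2}ΔΔ^{-3/2} = Δ⁻²`, and `Q′_kΔ⁻²Q′_k*(Q′_kΔ⁻²Q′_k*)⁻¹ = I` on `{⊥ 1}`.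
[cite: Balaban1984PropagatorsI, (1.52)–(1.54) p.27] -/
theorem Pv_mulVec_Pv (v : Tor (fine n M) × Fin d → ℂ) : Pv n M *ᵥ (Pv n M *ᵥ v) = Pv n M *ᵥ v := by
  rw [Pv_mulVec n M (Pv n M *ᵥ v), Pv_mulVec n M v, divS_GradOp_mulVec, m32_LapS_m32,
    QsOp_LapSinv2_QsAdj_Einv n M _ (sum_QsOp_m32 n M v)]

/-- `P² = P` as matrices. [folklore] -/
theorem Pv_mul_Pv : Pv n M * Pv n M = Pv n M :=
  B5Value126.ext_of_mulVec fun v => by rw [← Matrix.mulVec_mulVec, Pv_mulVec_Pv]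

/-- **(1.52)** «This can be written as (I − P)A′ + Δ^{-1/2}Q_k*ω + Δ^{-1/2}∂λ = 0».
[cite: Balaban1984PropagatorsI, (1.52) p.27] -/
theorem e152 {B : Tor M × Fin d → ℂ} {A : Tor (fine n M) × Fin d → ℂ} {ω : Tor M × Fin d → ℂ}
    {lam : Tor (fine n M) → ℂ} (h : EL149 n M B A ω lam) :
    (1 - Pv n M) *ᵥ Ap n M A + LapPowV n M (-1 / 2) *ᵥ (QvAdj n M *ᵥ ω)
        + LapPowV n M (-1 / 2) *ᵥ (GradOp (fine n M) (n : ℂ) *ᵥ lam) = 0 := by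
  rw [Matrix.sub_mulVec, Matrix.one_mulVec, Pv_mulVec]
  exact e151 n M h

/-- **(1.53), first step** «A solvability condition for this equation is
PΔ^{-1/2}Q_k*ω + PΔ^{-1/2}∂λ = 0» — apply the projection `P` to (1.52) (`P(I − P) = 0`).
[cite: Balaban1984PropagatorsI, (1.53) p.27] -/
theorem e153a {B : Tor M × Fin d → ℂ} {A : Tor (fine n M) × Fin d → ℂ} {ω : Tor M × Fin d → ℂ}
    {lam : Tor (fine n M) → ℂ} (h : EL149 n M B A ω lam) :
    Pv n M *ᵥ (LapPowV n M (-1 / 2) *ᵥ (QvAdj n M *ᵥ ω))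
        + Pv n M *ᵥ (LapPowV n M (-1 / 2) *ᵥ (GradOp (fine n M) (n : ℂ) *ᵥ lam)) = 0 := by
  have key := congrArg (fun v => Pv n M *ᵥ v) (e152 n M h)
  simp only [Matrix.mulVec_add, Matrix.mulVec_zero] at key
  rw [Matrix.sub_mulVec, Matrix.one_mulVec, Matrix.mulVec_sub, Pv_mulVec_Pv, sub_self, zero_add] at key
  exact key

/-- **(1.53), second step** «PΔ^{-1/2}∂λ = ∂Δ^{-1/2}(I − R)λ», `I − R = PcT` — an identity
(`∂*∂ = Δ`, `Δ^{-3/2}Δ^{-1/2}Δ = Δ⁻¹`, `Δ^{-1/2}Δ⁻¹ = Δ^{-3/2}`). [cite: Balaban1984PropagatorsI, (1.53) p.27] -/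
theorem Pv_negHalf_GradOp (lam : Tor (fine n M) → ℂ) :
    Pv n M *ᵥ (LapPowV n M (-1 / 2) *ᵥ (GradOp (fine n M) (n : ℂ) *ᵥ lam))
      = GradOp (fine n M) (n : ℂ) *ᵥ (LapPowS (fine n M) (n : ℂ) (-1 / 2) *ᵥ
          ((1 - (1 - PcT n M (n : ℂ))) *ᵥ lam)) := by
  rw [sub_sub_cancel, Pv_mulVec, divS_LapPowV, divS_GradOp_mulVec, m32_mhalf_LapS, PcT_mulVec,
    negHalf_LapSinv, QsAdj_Einv]

/-- `Rλ = λ` means `(I − R)λ = PcTλ = 0`. [cite: Balaban1984PropagatorsI, (1.48) p.26 «Rλ = λ»] -/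
theorem PcT_eq_zero_of_R {lam : Tor (fine n M) → ℂ} (hR : (1 - PcT n M (n : ℂ)) *ᵥ lam = lam) :
    PcT n M (n : ℂ) *ᵥ lam = 0 := by
  rw [Matrix.sub_mulVec, Matrix.one_mulVec, sub_eq_self] at hR
  exact hR

/-- **(1.53)** «PΔ^{-1/2}Q_k*ω + PΔ^{-1/2}∂λ = PΔ^{-1/2}Q_k*ω + ∂Δ^{-1/2}(I − R)λ = PΔ^{-1/2}Q_k*ω = 0».
[cite: Balaban1984PropagatorsI, (1.53) p.27] -/
theorem e153 {B : Tor M × Fin d → ℂ} {A : Tor (fine n M) × Fin d → ℂ} {ω : Tor M × Fin d → ℂ}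
    {lam : Tor (fine n M) → ℂ} (hR : (1 - PcT n M (n : ℂ)) *ᵥ lam = lam) (h : EL149 n M B A ω lam) :
    Pv n M *ᵥ (LapPowV n M (-1 / 2) *ᵥ (QvAdj n M *ᵥ ω)) = 0 := by
  have key := e153a n M h
  rw [Pv_negHalf_GradOp, sub_sub_cancel, PcT_eq_zero_of_R n M hR, Matrix.mulVec_zero, Matrix.mulVec_zero,
    add_zero] at key
  exact key

/-- «where λ′ = Q′_kΔ^{-3/2}∂*A′». [cite: Balaban1984PropagatorsI, p.27 after (1.54)] -/
def lamp (A : Tor (fine n M) × Fin d → ℂ) : Tor M → ℂ :=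
  QsOp n M *ᵥ (LapPowS (fine n M) (n : ℂ) (-3 / 2) *ᵥ ((GradOp (fine n M) (n : ℂ))ᴴ *ᵥ Ap n M A))

/-- `λ′ ⊥ 1`. [folklore] -/
theorem sum_lamp (A : Tor (fine n M) × Fin d → ℂ) : ∑ y, lamp n M A y = 0 := sum_QsOp_m32 n M _

/-- «A′₁ = −Δ^{-1/2}Q_k*ω − Δ^{-1/2}∂λ». [cite: Balaban1984PropagatorsI, (1.54) p.27] -/
def A1p (ω : Tor M × Fin d → ℂ) (lam : Tor (fine n M) → ℂ) : Tor (fine n M) × Fin d → ℂ :=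
  -(LapPowV n M (-1 / 2) *ᵥ (QvAdj n M *ᵥ ω)) - LapPowV n M (-1 / 2) *ᵥ (GradOp (fine n M) (n : ℂ) *ᵥ lam)

/-- «A′₂ = ∂Δ^{-3/2}Q′_k*(Q′_kΔ⁻²Q′_k*)⁻¹λ′». [cite: Balaban1984PropagatorsI, (1.54) p.27] -/
def A2p (A : Tor (fine n M) × Fin d → ℂ) : Tor (fine n M) × Fin d → ℂ :=
  GradOp (fine n M) (n : ℂ) *ᵥ (LapPowS (fine n M) (n : ℂ) (-3 / 2) *ᵥ (QsAdj n M *ᵥ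
    (Einv n M *ᵥ lamp n M A)))

/-- **(1.54)** «We have the decomposition A′ = (I − P)A′ + PA′ = A′₁ + A′₂, A′₁ = −Δ^{-1/2}Q_k*ω −
Δ^{-1/2}∂λ, A′₂ = ∂Δ^{-3/2}Q′_k*(Q′_kΔ⁻²Q′_k*)⁻¹λ′» — from (1.52). [cite: Balaban1984PropagatorsI, (1.54) p.27] -/
theorem e154 {B : Tor M × Fin d → ℂ} {A : Tor (fine n M) × Fin d → ℂ} {ω : Tor M × Fin d → ℂ}
    {lam : Tor (fine n M) → ℂ} (h : EL149 n M B A ω lam) :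
    Ap n M A = A1p n M ω lam + A2p n M A
    ∧ (1 - Pv n M) *ᵥ Ap n M A = A1p n M ω lam ∧ Pv n M *ᵥ Ap n M A = A2p n M A := by
  have h2 : (1 - Pv n M) *ᵥ Ap n M A = A1p n M ω lam := by
    rw [A1p, ← sub_eq_zero, ← e152 n M h]
    abel
  have h3 : Pv n M *ᵥ Ap n M A = A2p n M A := by rw [Pv_mulVec, A2p, lamp]
  refine ⟨?_, h2, h3⟩
  rw [← h2, ← h3, Matrix.sub_mulVec, Matrix.one_mulVec, sub_add_cancel]

/-! ## §4 (1.55)–(1.57): substituting into the two constraint equations -/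

/-- `Δ^{-1/2}A′₁ = −Δ⁻¹Q_k*ω − Δ⁻¹∂λ`. [cite: Balaban1984PropagatorsI, (1.56) p.27] -/
theorem negHalf_A1p (ω : Tor M × Fin d → ℂ) (lam : Tor (fine n M) → ℂ) :
    LapPowV n M (-1 / 2) *ᵥ A1p n M ω lam
      = -(LapVinv n M *ᵥ (QvAdj n M *ᵥ ω)) - LapVinv n M *ᵥ (GradOp (fine n M) (n : ℂ) *ᵥ lam) := by
  rw [A1p, Matrix.mulVec_sub, Matrix.mulVec_neg, negHalf_negHalf, negHalf_negHalf]

/-- `Δ^{-1/2}A′₂ = ∂Δ⁻²Q′_k*(Q′_kΔ⁻²Q′_k*)⁻¹λ′`. [cite: Balaban1984PropagatorsI, (1.56) p.27, (1.59) p.28] -/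
theorem negHalf_A2p (A : Tor (fine n M) × Fin d → ℂ) :
    LapPowV n M (-1 / 2) *ᵥ A2p n M A
      = GradOp (fine n M) (n : ℂ) *ᵥ (LapSinv (fine n M) (n : ℂ) *ᵥ (LapSinv (fine n M) (n : ℂ) *ᵥ
          (QsAdj n M *ᵥ (Einv n M *ᵥ lamp n M A)))) := by
  rw [A2p, LapPowV_GradOp, (m32_mhalf n M _).2]

/-- `Q_kΔ^{-1/2}A′₂ = ∂₁Q′_kΔ⁻²Q′_k*(Q′_kΔ⁻²Q′_k*)⁻¹λ′ = ∂₁λ′` — «using the identity Q_k∂ = ∂₁Q′_k, (1.55)»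
(`B5Hk160Torus.QvOp_GradOp_mulVec`). [cite: Balaban1984PropagatorsI, (1.55)–(1.56) p.27] -/
theorem QvOp_negHalf_A2p (A : Tor (fine n M) × Fin d → ℂ) :
    QvOp n M *ᵥ (LapPowV n M (-1 / 2) *ᵥ A2p n M A) = GradOp M 1 *ᵥ lamp n M A := by
  rw [negHalf_A2p, QvOp_GradOp_mulVec, QsOp_LapSinv2_QsAdj_Einv n M _ (sum_lamp n M A)]

/-- `Q_kΔ^{-1/2}A′₁ = −Q_kΔ⁻¹Q_k*ω − Q_kΔ⁻¹∂λ`. [cite: Balaban1984PropagatorsI, (1.56) p.27] -/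
theorem QvOp_negHalf_A1p (ω : Tor M × Fin d → ℂ) (lam : Tor (fine n M) → ℂ) :
    QvOp n M *ᵥ (LapPowV n M (-1 / 2) *ᵥ A1p n M ω lam)
      = -(QvOp n M *ᵥ (LapVinv n M *ᵥ (QvAdj n M *ᵥ ω)))
        - QvOp n M *ᵥ (LapVinv n M *ᵥ (GradOp (fine n M) (n : ℂ) *ᵥ lam)) := by
  rw [negHalf_A1p, Matrix.mulVec_sub, Matrix.mulVec_neg]

/-- **(1.56), first line** «Q_kΔ^{-1/2}A′₁ + ∂₁λ′ + Q_kA₀ = −Q_kΔ⁻¹Q_k*ω − Q_kΔ⁻¹∂λ + ∂₁λ′ + Q_kA₀ = B»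
— the second equation of (1.49) after the substitution `A = Δ^{-1/2}(A′₁ + A′₂) + A₀`, with
`Q_kΔ^{-1/2}A′₂ = ∂₁λ′` by (1.55). [cite: Balaban1984PropagatorsI, (1.56) p.27] -/
theorem e156a {B : Tor M × Fin d → ℂ} {A : Tor (fine n M) × Fin d → ℂ} {ω : Tor M × Fin d → ℂ}
    {lam : Tor (fine n M) → ℂ} (h : EL149 n M B A ω lam) :
    QvOp n M *ᵥ (LapPowV n M (-1 / 2) *ᵥ A1p n M ω lam) + GradOp M 1 *ᵥ lamp n M A
        + QvOp n M *ᵥ B0 (fine n M) A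
      = -(QvOp n M *ᵥ (LapVinv n M *ᵥ (QvAdj n M *ᵥ ω)))
        - QvOp n M *ᵥ (LapVinv n M *ᵥ (GradOp (fine n M) (n : ℂ) *ᵥ lam))
        + GradOp M 1 *ᵥ lamp n M A + QvOp n M *ᵥ B0 (fine n M) A
    ∧ -(QvOp n M *ᵥ (LapVinv n M *ᵥ (QvAdj n M *ᵥ ω)))
        - QvOp n M *ᵥ (LapVinv n M *ᵥ (GradOp (fine n M) (n : ℂ) *ᵥ lam))
        + GradOp M 1 *ᵥ lamp n M A + QvOp n M *ᵥ B0 (fine n M) A = B := by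
  refine ⟨by rw [QvOp_negHalf_A1p], ?_⟩
  have hQA : QvOp n M *ᵥ A = B := sub_eq_zero.mp h.2.1
  have hA : A = LapPowV n M (-1 / 2) *ᵥ A1p n M ω lam + LapPowV n M (-1 / 2) *ᵥ A2p n M A
      + B0 (fine n M) A := by
    rw [← Matrix.mulVec_add, ← (e154 n M h).1]
    exact A_decomp n M A
  have hQ := congrArg (fun v => QvOp n M *ᵥ v) hA
  simp only [Matrix.mulVec_add] at hQ
  rw [QvOp_negHalf_A1p, QvOp_negHalf_A2p] at hQ
  rw [← hQA, hQ]

/-- `∂*Δ⁻¹∂λ = Δ⁻¹Δλ = λ − (mean of λ)` on the torus. [folklore] -/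
theorem divS_LapVinv_GradOp (lam : Tor (fine n M) → ℂ) :
    (GradOp (fine n M) (n : ℂ))ᴴ *ᵥ (LapVinv n M *ᵥ (GradOp (fine n M) (n : ℂ) *ᵥ lam))
      = lam - fun _ => meanS (fine n M) lam := by
  have hnc : (n : ℂ) ≠ 0 := by exact_mod_cast NeZero.ne n
  rw [divS_LapVinv, divS_GradOp_mulVec, LapSinv_LapS_eq (fine n M) hnc]

/-- `R` fixes constants: `R a = a` (`Δ⁻¹a = 0`). [folklore] -/
theorem R_const (a : ℂ) :
    (1 - PcT n M (n : ℂ)) *ᵥ (fun _ : Tor (fine n M) => a) = fun _ => a := by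
  rw [Matrix.sub_mulVec, Matrix.one_mulVec, PcT_mulVec, LapSinv_const, Matrix.mulVec_zero,
    Matrix.mulVec_zero, Matrix.mulVec_zero, Matrix.mulVec_zero, sub_zero]

/-- `RΔ⁻¹Q′_kᴴg = 0` for `g ⊥ 1` — `Δ⁻¹Q′_kᴴg` lies in the range of the projection `I − R`
(`(Q′_kΔ⁻²Q′_k*)⁻¹(Q′_kΔ⁻²Q′_k*) = I` on `{⊥ 1}`). [cite: Balaban1984PropagatorsI, (1.28) p.22] -/
theorem R_LapSinv_QsOpH_of_orth (g : Tor M → ℂ) (hg : ∑ y, g y = 0) :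
    (1 - PcT n M (n : ℂ)) *ᵥ (LapSinv (fine n M) (n : ℂ) *ᵥ ((QsOp n M)ᴴ *ᵥ g)) = 0 := by
  have hnc : (n : ℂ) ≠ 0 := by exact_mod_cast NeZero.ne n
  rw [Matrix.sub_mulVec, Matrix.one_mulVec, PcT_mulVec, ← Mop_mulVec, Minv_Mop_of_orth n M (n : ℂ) hnc g hg,
    sub_self]

/-- `RΔ⁻¹Q′_k*u = 0` for `u ⊥ 1` (`Q′_k* = η^{-d}Q′_kᴴ`). [cite: Balaban1984PropagatorsI, (1.28) p.22] -/
theorem R_LapSinv_QsAdj_of_orth (u : Tor M → ℂ) (hu : ∑ y, u y = 0) :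
    (1 - PcT n M (n : ℂ)) *ᵥ (LapSinv (fine n M) (n : ℂ) *ᵥ (QsAdj n M *ᵥ u)) = 0 := by
  rw [QsAdj, Matrix.smul_mulVec, Matrix.mulVec_smul, Matrix.mulVec_smul,
    R_LapSinv_QsOpH_of_orth n M u hu, smul_zero]

/-- **(1.56), second line, on the torus**: «−R∂*Δ⁻¹Q_k*ω − R∂*Δ⁻¹∂λ + RΔ⁻¹Q′_k*(Q′_kΔ⁻²Q′_k*)⁻¹λ′ =
−RΔ⁻¹Q′_k*∂₁*ω − Rλ» `+ λ̄` — the third equation's left side `R∂*A` after the substitution; here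
`∂*Δ⁻¹Q_k*ω = Δ⁻¹Q′_k*∂₁*ω` ((1.55)*), `RΔ⁻¹Q′_k*(…)⁻¹λ′ = 0`, and on the torus `∂*Δ⁻¹∂λ = λ − λ̄`
with `λ̄` the mean of `λ` (in print `λ ⊥ 1` — `R` acts on divergences, p.24 — so `Δ⁻¹Δλ = λ` and
`λ̄ = 0`; see the header, DIVERGENCE (i)). [cite: Balaban1984PropagatorsI, (1.56) p.27] -/
theorem e156b {B : Tor M × Fin d → ℂ} {A : Tor (fine n M) × Fin d → ℂ} {ω : Tor M × Fin d → ℂ}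
    {lam : Tor (fine n M) → ℂ} (h : EL149 n M B A ω lam) :
    (1 - PcT n M (n : ℂ)) *ᵥ ((GradOp (fine n M) (n : ℂ))ᴴ *ᵥ A)
      = -((1 - PcT n M (n : ℂ)) *ᵥ ((GradOp (fine n M) (n : ℂ))ᴴ *ᵥ
            (LapVinv n M *ᵥ (QvAdj n M *ᵥ ω))))
        - (1 - PcT n M (n : ℂ)) *ᵥ ((GradOp (fine n M) (n : ℂ))ᴴ *ᵥ
            (LapVinv n M *ᵥ (GradOp (fine n M) (n : ℂ) *ᵥ lam)))
        + (1 - PcT n M (n : ℂ)) *ᵥ (LapSinv (fine n M) (n : ℂ) *ᵥ (QsAdj n M *ᵥ (Einv n M *ᵥ lamp n M A)))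
    ∧ (1 - PcT n M (n : ℂ)) *ᵥ ((GradOp (fine n M) (n : ℂ))ᴴ *ᵥ A)
      = -((1 - PcT n M (n : ℂ)) *ᵥ (LapSinv (fine n M) (n : ℂ) *ᵥ (QsAdj n M *ᵥ ((GradOp M 1)ᴴ *ᵥ ω))))
        - (1 - PcT n M (n : ℂ)) *ᵥ lam + fun _ => meanS (fine n M) lam := by
  have hnc : (n : ℂ) ≠ 0 := by exact_mod_cast NeZero.ne n
  have hA : A = LapPowV n M (-1 / 2) *ᵥ A1p n M ω lam + LapPowV n M (-1 / 2) *ᵥ A2p n M A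
      + B0 (fine n M) A := by
    rw [← Matrix.mulVec_add, ← (e154 n M h).1]
    exact A_decomp n M A
  have h1 : (1 - PcT n M (n : ℂ)) *ᵥ ((GradOp (fine n M) (n : ℂ))ᴴ *ᵥ A)
      = -((1 - PcT n M (n : ℂ)) *ᵥ ((GradOp (fine n M) (n : ℂ))ᴴ *ᵥ
            (LapVinv n M *ᵥ (QvAdj n M *ᵥ ω))))
        - (1 - PcT n M (n : ℂ)) *ᵥ ((GradOp (fine n M) (n : ℂ))ᴴ *ᵥ
            (LapVinv n M *ᵥ (GradOp (fine n M) (n : ℂ) *ᵥ lam)))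
        + (1 - PcT n M (n : ℂ)) *ᵥ (LapSinv (fine n M) (n : ℂ) *ᵥ (QsAdj n M *ᵥ
            (Einv n M *ᵥ lamp n M A))) := by
    have hd : (GradOp (fine n M) (n : ℂ))ᴴ *ᵥ A
        = -((GradOp (fine n M) (n : ℂ))ᴴ *ᵥ (LapVinv n M *ᵥ (QvAdj n M *ᵥ ω)))
          - (GradOp (fine n M) (n : ℂ))ᴴ *ᵥ (LapVinv n M *ᵥ (GradOp (fine n M) (n : ℂ) *ᵥ lam))
          + LapSinv (fine n M) (n : ℂ) *ᵥ (QsAdj n M *ᵥ (Einv n M *ᵥ lamp n M A)) := by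
      conv_lhs => rw [hA]
      rw [Matrix.mulVec_add, Matrix.mulVec_add, negHalf_A1p, negHalf_A2p, B0, divS_constV, add_zero,
        Matrix.mulVec_sub, Matrix.mulVec_neg, divS_GradOp_mulVec, LapS_LapSinv_LapSinv]
    rw [hd, Matrix.mulVec_add, Matrix.mulVec_sub, Matrix.mulVec_neg]
  refine ⟨h1, ?_⟩
  rw [h1, divS_LapVinv, divS_QvAdj, divS_LapVinv_GradOp, Matrix.mulVec_sub, R_const, QsAdj_Einv,
    R_LapSinv_QsOpH_of_orth n M _ (sum_Minv_of_orth n M (n : ℂ) hnc _ (sum_lamp n M A)), add_zero]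
  abel

/-- **(1.56) ⇒ «−Rλ = −λ = 0» on the torus: `λ` IS CONSTANT** — the third equation `R∂*A = 0`, the
second line of (1.56), `RΔ⁻¹Q′_k*∂₁*ω = 0` (as `∂₁*ω ⊥ 1`) and `Rλ = λ` give `λ = λ̄`; hence `∂λ = 0`
(in print, where `R` acts on the mean-zero functions `∂*A` (p.24), this reads `λ = 0`; see the header,
DIVERGENCE (i)). [cite: Balaban1984PropagatorsI, (1.56) p.27, (1.38) p.24] -/
theorem lam_const {B : Tor M × Fin d → ℂ} {A : Tor (fine n M) × Fin d → ℂ} {ω : Tor M × Fin d → ℂ}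
    {lam : Tor (fine n M) → ℂ} (hR : (1 - PcT n M (n : ℂ)) *ᵥ lam = lam) (h : EL149 n M B A ω lam) :
    (lam = fun _ => meanS (fine n M) lam) ∧ GradOp (fine n M) (n : ℂ) *ᵥ lam = 0 := by
  have key := (e156b n M h).2
  have hu : ∑ y, ((GradOp M 1)ᴴ *ᵥ ω) y = 0 := by
    rw [GradOp_conjTranspose_mulVec_eq]
    exact sum_divS M 1 ω
  rw [h.2.2, R_LapSinv_QsAdj_of_orth n M _ hu, hR, neg_zero, zero_sub, eq_comm, neg_add_eq_zero] at key
  refine ⟨key, ?_⟩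
  rw [key, GradOp_const]

/-- **(1.57)** «The second equation gets the form −Q_kΔ⁻¹Q_k*ω + ∂₁λ′ + Q_kA₀ = B» (`∂λ = 0`).
[cite: Balaban1984PropagatorsI, (1.57) p.27] -/
theorem e157 {B : Tor M × Fin d → ℂ} {A : Tor (fine n M) × Fin d → ℂ} {ω : Tor M × Fin d → ℂ}
    {lam : Tor (fine n M) → ℂ} (hR : (1 - PcT n M (n : ℂ)) *ᵥ lam = lam) (h : EL149 n M B A ω lam) :
    -(QvOp n M *ᵥ (LapVinv n M *ᵥ (QvAdj n M *ᵥ ω))) + GradOp M 1 *ᵥ lamp n M A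
        + QvOp n M *ᵥ B0 (fine n M) A = B := by
  have key := (e156a n M h).2
  rw [(lam_const n M hR h).2, Matrix.mulVec_zero, Matrix.mulVec_zero, sub_zero] at key
  exact key

/-- `Q_kΔ⁻¹V ⊥ constants` (no constant mode survives `Δ⁻¹`; `Q_k` preserves means up to `η^d`).
[folklore] -/
theorem orthConst_QvOp_LapVinv (V : Tor (fine n M) × Fin d → ℂ) :
    OrthConst M (QvOp n M *ᵥ (LapVinv n M *ᵥ V)) := by
  intro μ
  have h0 : ∑ x, (LapVinv n M *ᵥ V) (x, μ) = 0 := by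
    have h := sum_LapSinv (fine n M) (n : ℂ) (comp (fine n M) V μ)
    rw [← comp_LapVinv_mulVec] at h
    exact h
  rw [sum_QvOp, h0, mul_zero]

/-- «It implies that B − Q_kA₀ is orthogonal to constant functions». [cite: Balaban1984PropagatorsI, p.27] -/
theorem orthConst_B_sub {B : Tor M × Fin d → ℂ} {A : Tor (fine n M) × Fin d → ℂ} {ω : Tor M × Fin d → ℂ}
    {lam : Tor (fine n M) → ℂ} (hR : (1 - PcT n M (n : ℂ)) *ᵥ lam = lam) (h : EL149 n M B A ω lam) :
    OrthConst M (B - QvOp n M *ᵥ B0 (fine n M) A) := by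
  have e : B - QvOp n M *ᵥ B0 (fine n M) A
      = GradOp M 1 *ᵥ lamp n M A - QvOp n M *ᵥ (LapVinv n M *ᵥ (QvAdj n M *ᵥ ω)) := by
    rw [← e157 n M hR h]
    abel
  rw [e]
  exact orthConst_sub M (orthConst_GradOp M 1 _) (orthConst_QvOp_LapVinv n M _)

omit hM in
/-- the mean of a mean-free configuration vanishes: `(X)₀ = 0` for `X ⊥ constants`. [folklore] -/
theorem B0_eq_zero_of_orthConst (N : Fin d → ℕ) [∀ ν, NeZero (N ν)] {X : Tor N × Fin d → ℂ}
    (hX : OrthConst N X) : B0 N X = 0 := by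
  funext ⟨y, μ⟩
  show ((Fintype.card (Tor N) : ℂ))⁻¹ * ∑ y, X (y, μ) = 0
  rw [hX μ, mul_zero]

omit hM in
/-- the mean of a constant configuration is itself. [folklore] -/
theorem B0_constV (N : Fin d → ℕ) [∀ ν, NeZero (N ν)] (c : Fin d → ℂ) : B0 N (constV N c) = constV N c := by
  have hc : ((Fintype.card (Tor N) : ℂ)) ≠ 0 := Nat.cast_ne_zero.mpr Fintype.card_ne_zero
  funext ⟨y, μ⟩
  show ((Fintype.card (Tor N) : ℂ))⁻¹ * ∑ y : Tor N, c μ = c μ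
  rw [Finset.sum_const, Finset.card_univ, nsmul_eq_mul, ← mul_assoc, inv_mul_cancel₀ hc, one_mul]

/-- **«Taking the decomposition B = B′ + B₀ … we can identify Q_kA₀ = B₀»** — project (1.57) onto the
constant configurations. [cite: Balaban1984PropagatorsI, p.27 before (1.58)] -/
theorem QvOp_A0 {B : Tor M × Fin d → ℂ} {A : Tor (fine n M) × Fin d → ℂ} {ω : Tor M × Fin d → ℂ}
    {lam : Tor (fine n M) → ℂ} (hR : (1 - PcT n M (n : ℂ)) *ᵥ lam = lam) (h : EL149 n M B A ω lam) :
    QvOp n M *ᵥ B0 (fine n M) A = B0 M B := by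
  have hω := orthConst_omega n M h
  rw [← P0M_mulVec M B, ← e157 n M hR h, Matrix.mulVec_add, Matrix.mulVec_add, Matrix.mulVec_neg,
    P0M_mulVec, P0M_mulVec, P0M_mulVec, B0_eq_zero_of_orthConst M (orthConst_QvOp_LapVinv n M _),
    B0_eq_zero_of_orthConst M (orthConst_GradOp M 1 _), neg_zero, zero_add, zero_add, B0, QvOp_constV,
    B0_constV]

/-- **«or A₀ = Q_k*B₀»**. [cite: Balaban1984PropagatorsI, p.27 before (1.58)] -/
theorem A0_eq {B : Tor M × Fin d → ℂ} {A : Tor (fine n M) × Fin d → ℂ} {ω : Tor M × Fin d → ℂ}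
    {lam : Tor (fine n M) → ℂ} (hR : (1 - PcT n M (n : ℂ)) *ᵥ lam = lam) (h : EL149 n M B A ω lam) :
    B0 (fine n M) A = QvAdj n M *ᵥ B0 M B := by
  rw [← QvOp_A0 n M hR h, B0, QvOp_constV, QvAdj_constV]

/-- `(Q′_kΔ⁻²Q′_k*)⁻¹(Q′_kΔ⁻²Q′_k*)u = u` for `u ⊥ 1`, in the weighted conventions
`Q′_k* = QsAdj`, `(…)⁻¹ = Einv`. [cite: Balaban1984PropagatorsI, Sect. C p.22] -/
theorem Einv_QsOp_LapSinv2_QsAdj (u : Tor M → ℂ) (hu : ∑ y, u y = 0) :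
    Einv n M *ᵥ (QsOp n M *ᵥ (LapSinv (fine n M) (n : ℂ) *ᵥ (LapSinv (fine n M) (n : ℂ) *ᵥ
        (QsAdj n M *ᵥ u)))) = u := by
  have hnc : (n : ℂ) ≠ 0 := by exact_mod_cast NeZero.ne n
  have hnd : ((n : ℂ) ^ d) ≠ 0 := pow_ne_zero _ hnc
  rw [QsAdj, Einv, Matrix.smul_mulVec, Matrix.smul_mulVec, Matrix.mulVec_smul, Matrix.mulVec_smul,
    Matrix.mulVec_smul, Matrix.mulVec_smul, smul_smul, inv_mul_cancel₀ hnd, one_smul, ← Mop_mulVec,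
    Minv_Mop_of_orth n M (n : ℂ) hnc u hu]

/-- **the displayed solvability condition** «PΔ^{-1/2}Q_k*ω = ∂Δ^{-3/2}Q′_k*(Q′_kΔ⁻²Q′_k*)⁻¹Q′_kΔ⁻²Q′_k*∂₁*ω»
— an identity (`∂*Δ^{-1/2}Q_k* = Δ^{-1/2}Q′_k*∂₁*`, `Δ^{-3/2}Δ^{-1/2} = Δ⁻²`).
[cite: Balaban1984PropagatorsI, p.27 before (1.58)] -/
theorem e153_display (ω : Tor M × Fin d → ℂ) :
    Pv n M *ᵥ (LapPowV n M (-1 / 2) *ᵥ (QvAdj n M *ᵥ ω))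
      = GradOp (fine n M) (n : ℂ) *ᵥ (LapPowS (fine n M) (n : ℂ) (-3 / 2) *ᵥ (QsAdj n M *ᵥ (Einv n M *ᵥ
          (QsOp n M *ᵥ (LapSinv (fine n M) (n : ℂ) *ᵥ (LapSinv (fine n M) (n : ℂ) *ᵥ
            (QsAdj n M *ᵥ ((GradOp M 1)ᴴ *ᵥ ω)))))))) := by
  rw [Pv_mulVec, divS_LapPowV, divS_QvAdj, (m32_mhalf n M _).1]

/-- **«which is equivalent to ∂₁*ω = 0»** — `∂Δ^{-3/2}Q′_k*` is injective on `{⊥ 1}` (a gradient-free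
mean-free scalar vanishes; `Δ^{-3/2}` and `Q′_k*` are injective there).
[cite: Balaban1984PropagatorsI, p.27 before (1.58)] -/
theorem e153_iff (ω : Tor M × Fin d → ℂ) :
    Pv n M *ᵥ (LapPowV n M (-1 / 2) *ᵥ (QvAdj n M *ᵥ ω)) = 0 ↔ (GradOp M 1)ᴴ *ᵥ ω = 0 := by
  have hnc : (n : ℂ) ≠ 0 := by exact_mod_cast NeZero.ne n
  have hnd : ((n : ℂ) ^ d) ≠ 0 := pow_ne_zero _ hnc
  have hu : ∑ y, ((GradOp M 1)ᴴ *ᵥ ω) y = 0 := by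
    rw [GradOp_conjTranspose_mulVec_eq]
    exact sum_divS M 1 ω
  rw [e153_display, Einv_QsOp_LapSinv2_QsAdj n M _ hu]
  constructor
  · intro h0
    set u := (GradOp M 1)ᴴ *ᵥ ω with hu_def
    have hw : LapPowS (fine n M) (n : ℂ) (-3 / 2) *ᵥ (QsAdj n M *ᵥ u) = 0 :=
      eq_zero_of_GradOp_eq_zero (fine n M) hnc h0 (sum_LapPowS (fine n M) (n : ℂ) (by norm_num) _)
    have hsum : ∑ x, (QsAdj n M *ᵥ u) x = 0 := by
      rw [QsAdj, Matrix.smul_mulVec]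
      simp only [Pi.smul_apply, smul_eq_mul, ← Finset.mul_sum]
      rw [sum_QsOp_adjoint, hu, mul_zero]
    have hdft : dft (fine n M) *ᵥ (QsAdj n M *ᵥ u) = dft (fine n M) *ᵥ (0 : Tor (fine n M) → ℂ) := by
      funext p
      rw [Matrix.mulVec_zero, Pi.zero_apply]
      by_cases hp : p = 0
      · subst hp
        exact (sum_eq_zero_iff_dft_zero (fine n M) _).mp hsum
      · exact dft_eq_zero_of_LapPowS_eq_zero (fine n M) hnc _ hw hp
    have hQ : QsAdj n M *ᵥ u = 0 := dft_mulVec_injective (fine n M) hdft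
    rw [QsAdj, Matrix.smul_mulVec, smul_eq_zero] at hQ
    exact QsOp_adjoint_injective n M u (hQ.resolve_left hnd)
  · intro h0
    rw [h0, Matrix.mulVec_zero, Matrix.mulVec_zero, Matrix.mulVec_zero]

/-- **«Equation (1.57) can be solved with respect to ω and we get ω = + φ⁻¹∂₁λ′ − φ⁻¹B′»**, `φ = Q_kΔ⁻¹Q_k*`
(1.58) `= B5Phi162Torus.PhiOp`, `φ⁻¹ = PhiInv` (inverse on `{⊥ constants}`, where `ω` lies).
[cite: Balaban1984PropagatorsI, p.27 after (1.58)] -/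
theorem omega_eq {B : Tor M × Fin d → ℂ} {A : Tor (fine n M) × Fin d → ℂ} {ω : Tor M × Fin d → ℂ}
    {lam : Tor (fine n M) → ℂ} (hR : (1 - PcT n M (n : ℂ)) *ᵥ lam = lam) (h : EL149 n M B A ω lam) :
    ω = PhiInv n M *ᵥ (GradOp M 1 *ᵥ lamp n M A) - PhiInv n M *ᵥ Bp M B := by
  have hn : 1 ≤ n := Nat.one_le_iff_ne_zero.mpr (NeZero.ne n)
  have hω := orthConst_omega n M h
  have k := e157 n M hR h
  rw [QvOp_A0 n M hR h, ← PhiOp_mulVec] at k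
  have hP : PhiOp n M *ᵥ ω = GradOp M 1 *ᵥ lamp n M A - Bp M B := by
    rw [Bp]
    set b0 := B0 M B with hb0
    rw [← k]
    abel
  calc ω = PhiInv n M *ᵥ (PhiOp n M *ᵥ ω) := (PhiInv_PhiOp_of_orthConst n M hn hω).symm
    _ = PhiInv n M *ᵥ (GradOp M 1 *ᵥ lamp n M A) - PhiInv n M *ᵥ Bp M B := by rw [hP, Matrix.mulVec_sub]

/-- **«The solvability condition gives the equation ∂₁*ω = ∂₁*φ⁻¹∂₁λ′ − ∂₁*φ⁻¹B′ = 0»**.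
[cite: Balaban1984PropagatorsI, p.27 after (1.58)] -/
theorem e153_solved {B : Tor M × Fin d → ℂ} {A : Tor (fine n M) × Fin d → ℂ} {ω : Tor M × Fin d → ℂ}
    {lam : Tor (fine n M) → ℂ} (hR : (1 - PcT n M (n : ℂ)) *ᵥ lam = lam) (h : EL149 n M B A ω lam) :
    (GradOp M 1)ᴴ *ᵥ ω = 0
    ∧ (GradOp M 1)ᴴ *ᵥ (PhiInv n M *ᵥ (GradOp M 1 *ᵥ lamp n M A))
        - (GradOp M 1)ᴴ *ᵥ (PhiInv n M *ᵥ Bp M B) = 0 := by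
  have h0 : (GradOp M 1)ᴴ *ᵥ ω = 0 := (e153_iff n M ω).mp (e153 n M hR h)
  refine ⟨h0, ?_⟩
  rw [← Matrix.mulVec_sub, ← omega_eq n M hR h]
  exact h0

/-- `(∂₁*φ⁻¹∂₁)⁻¹(∂₁*φ⁻¹∂₁)t = t` for `t ⊥ 1` (the left-inverse companion of
`B5Hk160Torus.GPhi_GPhiInv_of_orth`). [cite: Balaban1984PropagatorsI, p.27 before (1.59)] -/
theorem GPhiInv_GPhi_of_orth (t : Tor M → ℂ) (ht : ∑ y, t y = 0) :
    GPhiInv n M *ᵥ (GPhi n M *ᵥ t) = t := by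
  refine dft_mulVec_injective M ?_
  funext q
  show (dft M *ᵥ (GPhiInv n M *ᵥ (GPhi n M *ᵥ t))) q = (dft M *ᵥ t) q
  rw [GPhiInv, dft_sMul, dft_GPhi, ← mul_assoc]
  by_cases hq : q = 0
  · subst hq
    rw [(sum_eq_zero_iff_dft_zero M t).mp ht, mul_zero]
  · rw [inv_mul_cancel₀ (gsym_ne_zero n M hq), one_mul]

/-- **«This equation can be solved with respect to λ′, and we get λ′ = (∂₁*φ⁻¹∂₁)⁻¹∂₁*φ⁻¹B′»**
(`= B5Hk160Torus.Lam`). [cite: Balaban1984PropagatorsI, p.27 before (1.59)] -/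
theorem lamp_eq_Lam {B : Tor M × Fin d → ℂ} {A : Tor (fine n M) × Fin d → ℂ} {ω : Tor M × Fin d → ℂ}
    {lam : Tor (fine n M) → ℂ} (hR : (1 - PcT n M (n : ℂ)) *ᵥ lam = lam) (h : EL149 n M B A ω lam) :
    lamp n M A = Lam n M B := by
  have hG : GPhi n M *ᵥ lamp n M A = (GradOp M 1)ᴴ *ᵥ (PhiInv n M *ᵥ Bp M B) := by
    rw [GPhi, ← Matrix.mulVec_mulVec, ← Matrix.mulVec_mulVec, ← sub_eq_zero]
    exact (e153_solved n M hR h).2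
  rw [← GPhiInv_GPhi_of_orth n M _ (sum_lamp n M A), hG, Lam]

/-! ## §5 (1.59): the minimal configuration, and the converse -/

/-- **(1.59)** «These calculations lead to the following result for the minimal configuration A, i.e. for
the solution of Eq. (1.49): A = Δ⁻¹Q_k*(φ⁻¹B′ − φ⁻¹∂₁(∂₁*φ⁻¹∂₁)⁻¹∂₁*φ⁻¹B′)
+ ∂Δ⁻²Q′_k*(Q′_kΔ⁻²Q′_k*)⁻¹(∂₁*φ⁻¹∂₁)⁻¹∂₁*φ⁻¹B′ + Q_k*B₀» (`= B5Hk160Torus.H159`): EVERY solution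
`(A, ω, λ)`, `Rλ = λ`, of the Lagrange system (1.49) has `A` given by (1.59).
[cite: Balaban1984PropagatorsI, (1.59) p.28] -/
theorem A_eq_H159 {B : Tor M × Fin d → ℂ} {A : Tor (fine n M) × Fin d → ℂ} {ω : Tor M × Fin d → ℂ}
    {lam : Tor (fine n M) → ℂ} (hR : (1 - PcT n M (n : ℂ)) *ᵥ lam = lam) (h : EL149 n M B A ω lam) :
    A = H159 n M B := by
  have hA : A = LapPowV n M (-1 / 2) *ᵥ A1p n M ω lam + LapPowV n M (-1 / 2) *ᵥ A2p n M A
      + B0 (fine n M) A := by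
    rw [← Matrix.mulVec_add, ← (e154 n M h).1]
    exact A_decomp n M A
  rw [hA, negHalf_A1p, negHalf_A2p, (lam_const n M hR h).2, Matrix.mulVec_zero, sub_zero,
    lamp_eq_Lam n M hR h, omega_eq n M hR h, lamp_eq_Lam n M hR h, A0_eq n M hR h, H159, theta,
    ← Matrix.mulVec_neg, ← Matrix.mulVec_neg, neg_sub]

/-- **(1.59) = (1.60)**: every solution of (1.49) has `A = H_kB` (`B5Hk160Torus.H160`,
`H159_eq_H160`). [cite: Balaban1984PropagatorsI, (1.59)–(1.60) p.28] -/
theorem A_eq_H160 {B : Tor M × Fin d → ℂ} {A : Tor (fine n M) × Fin d → ℂ} {ω : Tor M × Fin d → ℂ}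
    {lam : Tor (fine n M) → ℂ} (hR : (1 - PcT n M (n : ℂ)) *ᵥ lam = lam) (h : EL149 n M B A ω lam) :
    A = H160 n M B :=
  (A_eq_H159 n M hR h).trans (H159_eq_H160 n M B)

/-- the multipliers are determined too: `ω = φ⁻¹∂₁λ′ − φ⁻¹B′` with `λ′ = Lam B` (`= B5Hk160Torus.omegaW`),
and `λ` is a constant. [cite: Balaban1984PropagatorsI, p.27] -/
theorem multipliers_eq {B : Tor M × Fin d → ℂ} {A : Tor (fine n M) × Fin d → ℂ} {ω : Tor M × Fin d → ℂ}
    {lam : Tor (fine n M) → ℂ} (hR : (1 - PcT n M (n : ℂ)) *ᵥ lam = lam) (h : EL149 n M B A ω lam) :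
    ω = omegaW n M B ∧ ∃ a : ℂ, lam = fun _ => a := by
  refine ⟨?_, ⟨meanS (fine n M) lam, (lam_const n M hR h).1⟩⟩
  rw [omega_eq n M hR h, lamp_eq_Lam n M hR h, omegaW]

/-- **CONVERSE: `(H_kB, ω, λ)` SOLVES (1.49)** for `ω = −φ⁻¹(B′ − ∂₁λ′)` and ANY constant `λ`
(`(Δ − ∂∂*)H_kB = Q_k*φ⁻¹B″`, `Q_kH_kB = B`, `R∂*H_kB = 0` from B5Hk160Torus; `∂(const) = 0`).
[cite: Balaban1984PropagatorsI, (1.49) p.26, (1.59)–(1.60) p.28] -/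
theorem el149_H160 (B : Tor M × Fin d → ℂ) (a : ℂ) :
    EL149 n M B (H160 n M B) (omegaW n M B) (fun _ => a) := by
  refine ⟨?_, ?_, ?_⟩
  · rw [Lap_sub_GradDiv, DstarD_H160, omegaW_eq, Matrix.mulVec_neg, GradOp_const, add_zero, add_neg_cancel]
  · rw [QvOp_H160, sub_self]
  · exact R_divS_H160 n M B

/-- **THE LAGRANGE SYSTEM (1.49) IS SOLVABLE EXACTLY AT `A = H_kB`**: `A` admits multipliers `ω`, `λ`
(`Rλ = λ`) solving (1.49) iff `A` is the configuration (1.59) = (1.60).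
[cite: Balaban1984PropagatorsI, (1.49) p.26, (1.59) p.28] -/
theorem exists_el149_iff (B : Tor M × Fin d → ℂ) (A : Tor (fine n M) × Fin d → ℂ) :
    (∃ ω lam, (1 - PcT n M (n : ℂ)) *ᵥ lam = lam ∧ EL149 n M B A ω lam) ↔ A = H160 n M B := by
  constructor
  · rintro ⟨ω, lam, hR, h⟩
    exact A_eq_H160 n M hR h
  · rintro rfl
    exact ⟨omegaW n M B, fun _ => 0, R_const n M 0, el149_H160 n M B 0⟩

/-- **… AND EXACTLY AT THE CONSTRAINED MINIMISER**: `A` minimises «the form ½⟨∂A, ∂A⟩ under the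
conditions Q_kA = B, R∂*A = 0» iff `A = H_kB` (`B5Hk160Torus.H160_minimum`, `H160_unique`); so the
paper's identification «the minimal configuration A, i.e. … the solution of Eq. (1.49)» is certified in
both directions. [cite: Balaban1984PropagatorsI, p.26 before (1.48), (1.59) p.28] -/
theorem isConstrainedMin_iff (B : Tor M × Fin d → ℂ) (A : Tor (fine n M) × Fin d → ℂ) :
    (QvOp n M *ᵥ A = B ∧ (1 - PcT n M (n : ℂ)) *ᵥ ((GradOp (fine n M) (n : ℂ))ᴴ *ᵥ A) = 0
      ∧ ∀ A₁, QvOp n M *ᵥ A₁ = B → (1 - PcT n M (n : ℂ)) *ᵥ ((GradOp (fine n M) (n : ℂ))ᴴ *ᵥ A₁) = 0 →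
          cEnergy n M A ≤ cEnergy n M A₁)
    ↔ A = H160 n M B := by
  constructor
  · rintro ⟨hA, hR, hmin⟩
    exact H160_unique n M B A hA hR (hmin _ (QvOp_H160 n M B) (R_divS_H160 n M B))
  · rintro rfl
    exact ⟨QvOp_H160 n M B, R_divS_H160 n M B, fun A₁ hA₁ _ => H160_minimum n M B A₁ hA₁⟩

/-- the triangle closed: (1.49) solvable at `A` ⟺ `A` is the constrained minimiser.
[cite: Balaban1984PropagatorsI, p.26, (1.49), (1.59)] -/
theorem exists_el149_iff_isConstrainedMin (B : Tor M × Fin d → ℂ) (A : Tor (fine n M) × Fin d → ℂ) :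
    (∃ ω lam, (1 - PcT n M (n : ℂ)) *ᵥ lam = lam ∧ EL149 n M B A ω lam)
    ↔ (QvOp n M *ᵥ A = B ∧ (1 - PcT n M (n : ℂ)) *ᵥ ((GradOp (fine n M) (n : ℂ))ᴴ *ᵥ A) = 0
      ∧ ∀ A₁, QvOp n M *ᵥ A₁ = B → (1 - PcT n M (n : ℂ)) *ᵥ ((GradOp (fine n M) (n : ℂ))ᴴ *ᵥ A₁) = 0 →
          cEnergy n M A ≤ cEnergy n M A₁) := by
  rw [exists_el149_iff, isConstrainedMin_iff]

end

end Literature.MathematicalPhysics.QuantumFieldTheory.Balaban1983to89.B5Lagrange149Torus
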